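import Summits.QuantumFields.QCD.Theorems.TiltedFlatness.Negative.TwoWellFloor
import Summits.QuantumFields.QCD.Theorems.TiltedFlatness.Negative.MasslessKernel
import Summits.QuantumFields.QCD.Theorems.TiltedFlatness.Negative.FreeStarFibre
import Summits.QuantumFields.QCD.Theorems.TiltedFlatness.Negative.FlatnessNeedsLoss
import Summits.QuantumFields.QCD.Theorems.TiltedFlatness.Negative.NfDependence
import Summits.QuantumFields.QCD.Theses.PauliWegnerSea

/-!
# Disproof of `TiltedFlatness` (crux K3 of route `PauliWegnerSea`) — findings

Standing-disprover work file.  Item history: stmt-QuantumFields-11511 (rev ≤ 3; clause (b)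
CONDITIONALLY REFUTED, seats `…-11511-0` and `…-11511-g2-0`, §1–§5) → **stmt-QuantumFields-14070** (rev 4 =
the repaired `C′`, seat `refuter-cdisprove-stmt-QuantumFields-14070-0`, §6–§9) → gen-2 seat
`refuter-cdisprove-stmt-QuantumFields-14070-g2-0` (§10: the picked line `circle-transport`, skeleton r2b).

## STATUS (2026-08-16, cycle 2 = gen 2, after the line was picked): still NO KILL — `C′` believed TRUE,
## all seven r2b stubs believed TRUE as stated; five load-bearing facts of the stubs CERTIFIED (§10)

Gen-2 summary (details §10): (i) corner audit of the seven registered stubs of `Lines/circle-transport.lean`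
(r2b) in Lean semantics — `m = 0` cube has volume `1`, `E`/`ι` empty, `K ≤ 0`, `θ₀` outside the cube
(periodicity), `r` non-injective, `ε ≥ 1`, `D = 0`, `W₀` arbitrary — none bites, every stub survives;
(ii) CERTIFIED (sorry-free, std axioms; landing as `Negative/CircleEngineExponent.lean`,
`Negative/FibreSmallBallsLoadBearing.lean`): `not_circleSmallBall_exponent_gt` — the 1-D engine cannot have
exponent `c > 1/(2D)` (witness `(1 − cos)^D`), so the line's final loss grows linearly in `N_f`;
`not_fibreSmallBalls_oneSided` — the TWO-SIDED circles `A·T·B` in the lead's stub are load-bearing (with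
one-sided circles `W·T`, `T·W` the abstract Haar small-ball statement is FALSE at `D = 0`, `n = 1`); and
`not_fibreSmallBalls_uniform_in_n` — its constants must degrade with the number `n` of listed coordinates
(`F = Π_{e<N} √((1+Re W(e)₀₀)/2)`, `Haar^N{F ≤ ε} → 1`); `not_fibreDensity_oneSided` — the untilt stub
`FibreDensity` is likewise FALSE with one-sided Lipschitz circles (`S_λ = λ(1−‖W(e)₀₀‖²)`, density at `1`
unbounded in `λ`), resting on the Haar-nullity lemma `haar_norm00_eq_one_null` (`{‖g₀₀‖ = 1} ⊂ SU(3)` is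
null: pairwise disjoint equi-massive rotated translates); `not_fibreDensity_uniform_in_n` — the untilt
exponent `p` must grow with `n` (`S = Σ_{e<N}(1 − Re W(e)₀₀)`, `Z = z^N`, `z < 1`);
(iii) in-tree engines the workers can import today: `PauliBandLimit.det_add_smul_add_smul_of_rank_le`
(`Theorems/PauliWegnerSeaPauliBandLimitDetRank.lean`, the Laurent-degree-by-rank lemma = `stub_bandLimit`'s
heart) and `FiniteSignBudgetAtTheSchemeVolume.stub_su3CircleWord`
(`Theorems/PauliWegnerSeaGluonicCompletionSu3CircleWord.lean`, `SU(3)` = 9-letter word in `P₁₂, R₁₂, P₀₁, R₀₁`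
= `stub_eulerWord` modulo writing the three other letters as conjugates `V·T·V⁻¹` of `T = P₀₁`);
(iv) reusable helpers: `trigPoly_mul`, `trigPoly_pow` (the stub's literal trig-poly shape is closed under
products — what `det diracMatrix = Π_f det D_W(m_f)` needs).

## STATUS (2026-08-16, cycle 1 on item 14070): NO KILL — `C′` is believed TRUE

`C′` = (a) `F(W₀) ≤ C(1+β)^p M_β` ∧ (b′) `ν_β(F ≤ εM_β) ≤ C(1+β)^p ε^c` on the two-star fibre,
constants depending on `N_f` only.  Every attack of this cycle failed for a STRUCTURAL reason
(§6), and the failure analysis yields a soft proof architecture (§8) that the provers can follow: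
untilt by a Lipschitz sandwich (`dν_β/dHaar ≤ e·c⁻¹K^{8n}(1+β)^{8n}`, `n ≤ 16` star links) plus
the FINITE UNIFORM VANISHING ORDER `k₀` of the fixed finite-dimensional family of star-link
polynomials (compactness of its sup-unit sphere × the group; analyticity; connectedness) — no
Remez/Brudnyi machinery is needed, `p = 8n + k₀ − 1` in (a), `p = 8n`, `c = 1/(k₀−1)` in (b′).
What this file CERTIFIES instead is which parts of `C′` are load-bearing (§7; all LANDED, sorry-free:
`Negative/MasslessKernel` p72940, `Negative/FreeStarFibre` p74106, `Negative/FlatnessNeedsLoss` p75895,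
`Negative/NfDependence` p75899):

* the `(1+β)^p` loss in (a) is NECESSARY: `not_flatnessClauseUniform` / `not_tiltedFlatnessNoLossA`
  (tree: `Theorems/TiltedFlatness/Negative/FlatnessNeedsLoss.lean`, this seat) — witness `N_f = 1`,
  `m = 0`, `L = 4`, trivial outside, one star: `F ≡ 0` on the (pure-gauge) minimisers of the star
  action, `F > 0` after one centre-free link twist, Laplace ⇒ `sup F / M_β → ∞`;
* the `(1+β)^p` loss in (b′) is NECESSARY modulo the twin-well kernel: §1–§3 (rev-3 history,
  `twinWell_refutes_smallBallClause`; tree: conditional refutation p71372 of rev 3);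
* the massless kernel theorem behind every structural zero of `F` is now PROVED:
  `kerWilsonDiracMassless_holds` (tree: `Theorems/TiltedFlatness/Negative/MasslessKernel.lean`,
  this seat; `det D_W(U;0,1) = 0 ⇔ U` has a non-zero parallel colour field) — of independent use
  to the provers of `FibreCofactorDomination` (its named risk: `det ≡ 0` two-star fibres);
* NOT load-bearing (information for the provers, §7.3): the mass box `mq ∈ [−2,2]^{N_f}` (the
  polynomial space `V` is mass-independent), `4 ≤ L` (finitely many extra finite-dimensional
  cases), `0 ≤ β` (only `rpow` hygiene; a negative tilt concentrates on action MAXIMA and the same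
  analysis applies with `|β|`).

Index:
* §1 `TiltedFlatnessRev3`, `SmallBallClause`, `smallBallClause_of_rev3` (history).
* §2 `TiltedFlatnessRepaired` (= current decl, `repaired_iff_current : … ↔ TiltedFlatness` is
  `Iff.rfl`), `FlatnessClause`, `flatnessClause_of_tiltedFlatness`, `rev3_implies_current`.
* §3 `TwinWell`, `twinWell_refutes_smallBallClause` (history; clause (b) without loss falls).
* §4.2 `KerWilsonDiracMassless` — NOW PROVED (`kerWilsonDiracMassless_holds`, §7.1).
* §7 (NEW) load-bearing analysis of `C′` in Lean: §7.1 kernel theorem; §7.2 `FlatnessClauseUniform`,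
  `not_flatnessClauseUniform`, `TiltedFlatnessNoLossA`, `not_tiltedFlatnessNoLossA`,
  `tiltedFlatness_of_noLossA`-direction bookkeeping; §7.3 the non-load-bearing hypotheses
  (`TiltedFlatnessAllMasses → TiltedFlatness`).
* §8 (NEW, docstrings) the soft proof architecture of `C′` as three precise targets
  (`UntiltSandwich`, `BallMassLowerBound`, `UniformSmallBall`) and the reduction.
* §9 refuted / open natural strengthenings and next attacks (`TiltedFlatnessUniformInNf`).
* §10 (gen 2) TARGETS = the seven r2b stubs of `circle-transport`: verdict table and corner audit (§10.0),
  `not_circleSmallBall_exponent_gt` + trig-poly helpers (§10.1), `not_fibreSmallBalls_oneSided`,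
  `not_fibreSmallBalls_uniform_in_n`, `haar_norm00_eq_one_null`, `not_fibreDensity_oneSided`,
  `not_fibreDensity_uniform_in_n` (§10.2),
  further strengthenings believed false but not certified (§10.3).

## §6  Attacks on `C′` this cycle (all failed — why)

| attack | outcome |
|---|---|
| formal junk (rpow bases, `M = 0` guard, `Nf = 0 ⇒ F ≡ 1`, `x = y`, `L = 4`, measurability of the indicator, `Z > 0`) | none: every `let` is a genuine object (cf. rattack note on the item) |
| β → ∞ on a fibre with `F ≡ 0` on ALL action minimisers (free star) resp. on HALF of them (twin well, the rev-3 killer) | kills (a) resp. (b) WITHOUT loss (§7.2 resp. §3), but `M_β` decays only polynomially (`F` vanishes to finite order transversally to the minimiser orbit) and the twin-well atom forms only at rate `(1+β)^{1/2}ε`, so `(1+β)^p` absorbs both — this IS the reason the planner's repair works |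
| β → ∞ with twin wells (order-by-disorder, asymmetric wells, IVT balancing) | atom of `F/M_β` at 0 has ν-mass → ½ but the small-ball bound degrades only like `(1+β)^{1/2}ε` (§5 of the old analysis); misses (b′) |
| large `N_f` at fixed fibre (`F = G^{N_f}`) | breaks UNIFORMITY IN `N_f` (§9: `ν(G^{N} ≤ εM) → Haar(G < E G) > 0`), which `C′` does not claim |
| unbounded masses / `L < 4` / `β < 0` | not excluded regimes of `C′`… but also harmless (§7.3) |
| vanishing-order blow-up (P vanishing to unbounded order somewhere on the unit sphere of `V`) | impossible: `V` finite-dimensional, elements real-analytic on the connected group, `ord` u.s.c. ⇒ bounded (`k₀ < ∞`); this is the heart of why `C′` resists |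
| literature (`Remez inequality compact group`, `small ball polynomial Haar`, `Łojasiewicz uniform family`) | only confirmations (Brudnyi local Remez for analytic families; Carbery–Wright; Nazarov–Sodin–Volberg); no counterexample family applies to a FIXED finite-dimensional space |

## §4  Why the unconditional kill is not Lean-landable (cycle-2 analysis)

4.1  An atom is forced.  Refuting (b) for all `(C, c)` needs instances with `ν(F ≤ εM) ≥ const`
for arbitrarily small `ε`, i.e. an atom at `0` in a limit law of `F/M`.  At fixed `β` the tilted law
is comparable to Haar (the fibre action ranges over `≤ 24·6`, uniformly in `L`, `U`), and under Haar
`F = |P|` with `P` in ONE finite-dimensional space `V` of polynomials in the `≤ 16` star links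
(bidegree `≤ (6N_f, 6N_f)` per link, independent of `L`, `U`, `mq`): the sup-normalised small-ball
function is continuous on the unit sphere of `V`, so no atom, uniformly — (b) is TRUE at bounded
`β` (constant `e^{O(β)}`).  `L → ∞` adds nothing.  Hence `β → ∞`: Laplace concentration of `ν_β`
on the argmin `Σ` of the fibre action, and an atom needs `ν_∞(F = 0) > 0 < M_∞`: a part of `Σ`
carrying limit mass on which `F ≡ 0` (ALL of it — `F` is analytic, a thin zero set is invisible),
and another part with `F > 0`.  Equal depth of the two parts is automatic only through a SYMMETRY
of the action (else: quantitative two-sided Laplace asymptotics on `SU(3)^8`, not formalisable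
soon); the "order-by-disorder" and "different vanishing order" variants were checked and need the
same quantitative control.

4.2  Certifying `F(O₁) = 0 < F(O₂)` in Lean.  `F = |det D_W(refit ·; m)|` is a `3072 × 3072`
determinant (`L = 4`, `N_f = 1`).  STRUCTURAL zeros exist exactly at `m = 0`:
`ker D_W(U; m = 0, r = 1) = {covariantly constant colour fields} ⊗ ℂ⁴` for EVERY unitary `U`
(`KerWilsonDiracMassless` below; proof: `Re⟨ψ, D ψ⟩ = 4‖ψ‖² − Σ_μ Re Σ_x ⟨ψ(x), U_{x,μ} ψ(x+μ)⟩ ≥ 0`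
by Cauchy–Schwarz, using only `γ_μ† = γ_μ` and `U` unitary, with equality iff
`U_{x,μ} ψ(x+μ) = ψ(x)` for all `x, μ`; conversely such `ψ` are killed since
`½Σ_μ[(1−γ_μ)+(1+γ_μ)] = 4`).  So at `m = 0`, `F(refit W) = 0 ⇔ refit W` has a parallel colour
section; for `m > 0`, `σ_min(D_W) ≥ m` (same argument) and `F` never vanishes; at `m = −2` the
eigenvalue `2` of the hopping term is interior to its numerical range — no structure.

4.3  NO-GO for certifiable twin wells at `m = 0`.  With the star at `x` (`= y`) and `ĝ_a = g_a P_a`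
(`P_a` = outside transport to the neighbour `n_a`), `F = 0 ⇔ ∃ v ∈ Fix(H_out) ∖ 0` with all
`ĝ_a v` equal, `H_out` = holonomy group of the outside on `Λ ∖ {x}` (connected!).  In `SU(3)`,
`dim Fix(H_out) ∈ {0, 1, 3}`: `0` ⇒ `F > 0` everywhere; `3` ⇒ outside pure gauge ⇒ the star is
UNFRUSTRATED ⇒ argmin = one gauge orbit, `F` constant on it; `1` (`Fix = ℂe₁`, couplings
`K_ab ∈ 1 ⊕ SU(2)`) ⇒ `F = 0 ⇔ q_a := ĝ_1⁻¹ ĝ_a ∈ Stab(e₁)` for all `a`.  Every algebraic symmetry of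
`(Haar^8, S)` — permutations of the 8 star links (lattice symmetries), right translations
`ĝ_a ↦ ĝ_a D_a`, complex conjugation composed with those — PRESERVES this locus (a non-constant
intertwiner `D_a e₁ = f_a` would be a parallel section of the `SU(2)` part of `K` on the star graph
`K_{2,2,2,2}`, which makes `K` pure gauge, i.e. unfrustrated); and every Ky-Fan-tight argmax
(`S ≤ 4(6 + λ₁(𝕂′) + λ₂(𝕂′))`, the only kind of exact certificate available for the frustrated
`SU(3)` star glass `Σ_{ab} Re tr(ĝ_a K_ab ĝ_b†)`) has `𝟙 ⊗ e₁` in the column span of the stacked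
`ĝ_a†`, hence again `q_a ∈ Stab(e₁)`: `F ≡ 0` on EVERY tight component.  So structural zeros never
separate certifiable twins; the two-star variants (`x ≠ y`, product fibre law) reduce to the same
condition per star.  Consequently a Lean witness must use an accidental zero `m* ≠ 0` located by a
SIGN CHANGE of the real polynomial `m ↦ det D_{O₁}(m)` plus a root-free interval for `O₂` — i.e.
verified signs of two `3072²` determinants with `ℚ(ζ₁₆)` entries (Woodbury with the free Green's
function at rational masses still leaves dense `396²`/`132²` number-field determinants), for which
the tree has no interval arithmetic or verified elimination; `native_decide` would leave the axiom
whitelist.  This is why the kill is filed CONDITIONALLY (§3) with the kernel stated as the crisp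
finite-dimensional hypothesis `TiltedFlatnessTwinWell`.

4.4  Dead ends recorded (one line each): unconditional `¬S` by degenerate instances (`Nf = 0` makes
`F ≡ 1`, true with `C ≥ 1`; `M = 0` guards (b); `x = y`, `L = 4` allowed but harmless); junk in the
Lean statement (none: Borel/compact instances on `SU(3)`, `Measure.pi` of `haarMeasure ⊤` is a
probability measure charging opens, all integrands continuous, `rpow` well-behaved, real
decidability instances — the statement's `let`-bound `refit/F/wt/Z/M` even unify definitionally
with independently written copies, which is what made §3 possible); IVT-in-a-parameter to balance
asymmetric wells (removes the need for Laplace prefactors but still needs an argmin certificate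
for a one-parameter family); flat outsides with twisted holonomy to make spectra explicit (flat
fillings of the star are a single orbit).

## §5  For the provers of the repaired crux and for the planner

* Clause (a) (`FlatnessClause`) is believed TRUE uniformly (item notes g43-37/g44-60: `Z ≤ e^{−βS_min}`,
  Lipschitz sublevel ball of Haar mass `≳ (1+β)^{−128}`, Remez on the fixed space `V`,
  `p = 128 + κ`); nothing here attacks it.
* (b′) with the loss `C(1+β)^p ε^c` is what `FMClosureUnquenched` can consume (`∀ q` room); the
  twin-well witness obeys `ν_β(F ≤ εM_β) ≲ (1+β)^{1/2} ε` and misses it.  Recommended repair: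
  restate K3 as `TiltedFlatnessRepaired` (or (a) alone) and regenerate K2's antecedent.
* Targets (lead's stuck stubs): none received this cycle.
-/

namespace Summit.QuantumFields.QCD.Cruxes.TiltedFlatness.Disproof


open Summit.QuantumFields.QCD.Theses.PauliWegnerSea

/-! ## §1  The refuted rev-3 text and its clause (b) -/

/-- FROZEN COPY of the rev-≤3 crux text (item stmt-QuantumFields-11511), conditionally refuted by
`Summit.QuantumFields.QCD.Theorems.PauliWegnerSeaTiltedFlatness_refuted` (p71372 @ 8ffabe2e) and
replaced in the route file by `C′` under the same name (rev 4, item 14070). -/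
def TiltedFlatnessRev3 : Prop :=
  open MeasureTheory Filter Literature.MathematicalPhysics.QuantumFieldTheory Literature.MathematicalPhysics.QuantumLattice Literature.Probability.LatticeModels in ∀ Nf : ℕ, ∃ C p c : ℝ, 0 < C ∧ 0 < c ∧ ∀ β : ℝ, 0 ≤ β → ∀ mq : Fin Nf → ℝ, (∀ f, -2 ≤ mq f ∧ mq f ≤ 2) → ∀ (L : ℕ) [NeZero L], 4 ≤ L → ∀ (U : GaugeConfig 4 L (Matrix.specialUnitaryGroup (Fin 3) ℂ)) (x y : TorusSite 4 L), let star : Edge 4 L → Prop := fun e => e.1 = x ∨ Site.shift e.1 e.2 = x ∨ e.1 = y ∨ Site.shift e.1 e.2 = y; let refit : GaugeConfig 4 L (Matrix.specialUnitaryGroup (Fin 3) ℂ) → GaugeConfig 4 L (Matrix.specialUnitaryGroup (Fin 3) ℂ) := fun W e => if star e then W e else U e; let F : GaugeConfig 4 L (Matrix.specialUnitaryGroup (Fin 3) ℂ) → ℝ := fun W => ‖(diracMatrix (refit W) mq).det‖; let wt : GaugeConfig 4 L (Matrix.specialUnitaryGroup (Fin 3) ℂ) → ℝ := fun W => Real.exp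 (-(β * wilsonAction (fundamentalRep (Fin 3)) (refit W))); let haar : Measure (GaugeConfig 4 L (Matrix.specialUnitaryGroup (Fin 3) ℂ)) := Measure.pi fun _ => haarProbability (Matrix.specialUnitaryGroup (Fin 3) ℂ); let Z : ℝ := ∫ W, wt W ∂haar; let M : ℝ := (∫ W, F W * wt W ∂haar) / Z; (∀ W₀ : GaugeConfig 4 L (Matrix.specialUnitaryGroup (Fin 3) ℂ), F W₀ ≤ C * (1 + β) ^ p * M) ∧ (0 < M → ∀ ε : ℝ, 0 < ε → (∫ W, (if F W ≤ ε * M then (1 : ℝ) else 0) * wt W ∂haar) / Z ≤ C * ε ^ c)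

/-- Clause (b) of the rev-3 `TiltedFlatness` alone (relative small balls under the star-conditional tilted
law, constants uniform in `β` and in the outside): the clause the twin-well witness kills.
Verbatim the crux text with conclusion (b) only (and the unused exponent `p` dropped). -/
def SmallBallClause : Prop :=
  open MeasureTheory Filter Literature.MathematicalPhysics.QuantumFieldTheory Literature.MathematicalPhysics.QuantumLattice Literature.Probability.LatticeModels in ∀ Nf : ℕ, ∃ C c : ℝ, 0 < C ∧ 0 < c ∧ ∀ β : ℝ, 0 ≤ β → ∀ mq : Fin Nf → ℝ, (∀ f, -2 ≤ mq f ∧ mq f ≤ 2) → ∀ (L : ℕ) [NeZero L], 4 ≤ L → ∀ (U : GaugeConfig 4 L (Matrix.specialUnitaryGroup (Fin 3) ℂ)) (x y : TorusSite 4 L), let star : Edge 4 L → Prop := fun e => e.1 = x ∨ Site.shift e.1 e.2 = x ∨ e.1 = y ∨ Site.shift e.1 e.2 = y; let refit : GaugeConfig 4 L (Matrix.specialUnitaryGroup (Fin 3) ℂ) → GaugeConfig 4 L (Matrix.specialUnitaryGroup (Fin 3) ℂ) := fun W e => if star e then W e else U e; let F : GaugeConfig 4 L (Matrix.specialUnitaryGroup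 (Fin 3) ℂ) → ℝ := fun W => ‖(diracMatrix (refit W) mq).det‖; let wt : GaugeConfig 4 L (Matrix.specialUnitaryGroup (Fin 3) ℂ) → ℝ := fun W => Real.exp (-(β * wilsonAction (fundamentalRep (Fin 3)) (refit W))); let haar : Measure (GaugeConfig 4 L (Matrix.specialUnitaryGroup (Fin 3) ℂ)) := Measure.pi fun _ => haarProbability (Matrix.specialUnitaryGroup (Fin 3) ℂ); let Z : ℝ := ∫ W, wt W ∂haar; let M : ℝ := (∫ W, F W * wt W ∂haar) / Z; (0 < M → ∀ ε : ℝ, 0 < ε → (∫ W, (if F W ≤ ε * M then (1 : ℝ) else 0) * wt W ∂haar) / Z ≤ C * ε ^ c)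

/-- The rev-3 text implies its clause (b). -/
theorem smallBallClause_of_rev3 (h : TiltedFlatnessRev3) : SmallBallClause := by
  intro Nf
  obtain ⟨C, p, c, hC, hc, H⟩ := h Nf
  refine ⟨C, c, hC, hc, fun β hβ mq hmq L _ hL U x y => ?_⟩
  exact (H β hβ mq hmq L hL U x y).2

/-! ## §2  The repaired statement `C′` and clause (a) -/

/-- The REPAIRED crux `C′` (the route's declared kill-criteria pivot): clause (a) verbatim and
(b′) relative small balls with the polynomial loss `C (1+β)^p ε^c` in place of `C ε^c`.
Believed true; the twin-well witness misses it. -/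
def TiltedFlatnessRepaired : Prop :=
  open MeasureTheory Filter Literature.MathematicalPhysics.QuantumFieldTheory Literature.MathematicalPhysics.QuantumLattice Literature.Probability.LatticeModels in ∀ Nf : ℕ, ∃ C p c : ℝ, 0 < C ∧ 0 < c ∧ ∀ β : ℝ, 0 ≤ β → ∀ mq : Fin Nf → ℝ, (∀ f, -2 ≤ mq f ∧ mq f ≤ 2) → ∀ (L : ℕ) [NeZero L], 4 ≤ L → ∀ (U : GaugeConfig 4 L (Matrix.specialUnitaryGroup (Fin 3) ℂ)) (x y : TorusSite 4 L), let star : Edge 4 L → Prop := fun e => e.1 = x ∨ Site.shift e.1 e.2 = x ∨ e.1 = y ∨ Site.shift e.1 e.2 = y; let refit : GaugeConfig 4 L (Matrix.specialUnitaryGroup (Fin 3) ℂ) → GaugeConfig 4 L (Matrix.specialUnitaryGroup (Fin 3) ℂ) := fun W e => if star e then W e else U e; let F : GaugeConfig 4 L (Matrix.specialUnitaryGroup (Fin 3) ℂ) → ℝ := fun W => ‖(diracMatrix (refit W) mq).det‖; let wt : GaugeConfig 4 L (Matrix.specialUnitaryGroup (Fin 3) ℂ) → ℝ := fun W => Real.exp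 (-(β * wilsonAction (fundamentalRep (Fin 3)) (refit W))); let haar : Measure (GaugeConfig 4 L (Matrix.specialUnitaryGroup (Fin 3) ℂ)) := Measure.pi fun _ => haarProbability (Matrix.specialUnitaryGroup (Fin 3) ℂ); let Z : ℝ := ∫ W, wt W ∂haar; let M : ℝ := (∫ W, F W * wt W ∂haar) / Z; (∀ W₀ : GaugeConfig 4 L (Matrix.specialUnitaryGroup (Fin 3) ℂ), F W₀ ≤ C * (1 + β) ^ p * M) ∧ (0 < M → ∀ ε : ℝ, 0 < ε → (∫ W, (if F W ≤ ε * M then (1 : ℝ) else 0) * wt W ∂haar) / Z ≤ C * (1 + β) ^ p * ε ^ c)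

/-- Clause (a) of `TiltedFlatness` alone (relative flatness `F(W₀) ≤ C(1+β)^p M`), believed TRUE
uniformly in `β`, masses, volume and outside (Laplace lower bound at Lipschitz scale + Remez on
the fixed finite-dimensional space of star-link polynomials). -/
def FlatnessClause : Prop :=
  open MeasureTheory Filter Literature.MathematicalPhysics.QuantumFieldTheory Literature.MathematicalPhysics.QuantumLattice Literature.Probability.LatticeModels in ∀ Nf : ℕ, ∃ C p : ℝ, 0 < C ∧ ∀ β : ℝ, 0 ≤ β → ∀ mq : Fin Nf → ℝ, (∀ f, -2 ≤ mq f ∧ mq f ≤ 2) → ∀ (L : ℕ) [NeZero L], 4 ≤ L → ∀ (U : GaugeConfig 4 L (Matrix.specialUnitaryGroup (Fin 3) ℂ)) (x y : TorusSite 4 L), let star : Edge 4 L → Prop := fun e => e.1 = x ∨ Site.shift e.1 e.2 = x ∨ e.1 = y ∨ Site.shift e.1 e.2 = y; let refit : GaugeConfig 4 L (Matrix.specialUnitaryGroup (Fin 3) ℂ) → GaugeConfig 4 L (Matrix.specialUnitaryGroup (Fin 3) ℂ) := fun W e => if star e then W e else U e; let F : GaugeConfig 4 L (Matrix.specialUnitaryGroup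 (Fin 3) ℂ) → ℝ := fun W => ‖(diracMatrix (refit W) mq).det‖; let wt : GaugeConfig 4 L (Matrix.specialUnitaryGroup (Fin 3) ℂ) → ℝ := fun W => Real.exp (-(β * wilsonAction (fundamentalRep (Fin 3)) (refit W))); let haar : Measure (GaugeConfig 4 L (Matrix.specialUnitaryGroup (Fin 3) ℂ)) := Measure.pi fun _ => haarProbability (Matrix.specialUnitaryGroup (Fin 3) ℂ); let Z : ℝ := ∫ W, wt W ∂haar; let M : ℝ := (∫ W, F W * wt W ∂haar) / Z; (∀ W₀ : GaugeConfig 4 L (Matrix.specialUnitaryGroup (Fin 3) ℂ), F W₀ ≤ C * (1 + β) ^ p * M)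

/-- `TiltedFlatness` implies its clause (a). -/
theorem flatnessClause_of_tiltedFlatness (h : TiltedFlatness) : FlatnessClause := by
  intro Nf
  obtain ⟨C, p, c, hC, -, H⟩ := h Nf
  refine ⟨C, p, hC, fun β hβ mq hmq L _ hL U x y => ?_⟩
  exact (H β hβ mq hmq L hL U x y).1

/-- `C′` is byte-identical to the CURRENT (rev-4) tree decl `TiltedFlatness` (item 14070). -/
theorem repaired_iff_current : TiltedFlatnessRepaired ↔ TiltedFlatness := Iff.rfl

/-- The refuted rev-3 text implies the current repaired crux (`C′` is a weakening: take
`p′ = max p 0`, use `1 ≤ (1+β)^{p′}` and `M ≥ 0`).  Recorded for the planner's bookkeeping: the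
restate lost nothing that was true. -/
theorem rev3_implies_current (h : TiltedFlatnessRev3) : TiltedFlatness := by
  intro Nf
  obtain ⟨C, p, c, hC, hc, H⟩ := h Nf
  refine ⟨C, max p 0, c, hC, hc, fun β hβ mq hmq L _ hL U x y => ?_⟩
  obtain ⟨ha, hb⟩ := H β hβ mq hmq L hL U x y
  have h1 : (1 : ℝ) ≤ (1 + β) ^ (max p 0) := Real.one_le_rpow (by linarith) (le_max_right _ _)
  have hp : (1 + β) ^ p ≤ (1 + β) ^ (max p 0) :=
    Real.rpow_le_rpow_of_exponent_le (by linarith) (le_max_left _ _)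
  refine ⟨fun W₀ => (ha W₀).trans ?_, fun hM ε hε => (hb hM ε hε).trans ?_⟩
  · have hM0 : 0 ≤ (∫ W, ‖(Literature.MathematicalPhysics.QuantumFieldTheory.diracMatrix
          (fun e => if (e.1 = x ∨ Literature.MathematicalPhysics.QuantumFieldTheory.Site.shift e.1 e.2 = x ∨
            e.1 = y ∨ Literature.MathematicalPhysics.QuantumFieldTheory.Site.shift e.1 e.2 = y) then W e else U e)
          mq).det‖ * Real.exp (-(β * Literature.MathematicalPhysics.QuantumFieldTheory.wilsonAction
            (Literature.MathematicalPhysics.QuantumLattice.fundamentalRep (Fin 3))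
            (fun e => if (e.1 = x ∨ Literature.MathematicalPhysics.QuantumFieldTheory.Site.shift e.1 e.2 = x ∨
              e.1 = y ∨ Literature.MathematicalPhysics.QuantumFieldTheory.Site.shift e.1 e.2 = y) then W e else U e)))
          ∂(MeasureTheory.Measure.pi fun _ : Literature.MathematicalPhysics.QuantumFieldTheory.Edge 4 L =>
            Literature.MathematicalPhysics.QuantumFieldTheory.haarProbability
              (Matrix.specialUnitaryGroup (Fin 3) ℂ))) /
        (∫ W, Real.exp (-(β * Literature.MathematicalPhysics.QuantumFieldTheory.wilsonAction
            (Literature.MathematicalPhysics.QuantumLattice.fundamentalRep (Fin 3))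
            (fun e => if (e.1 = x ∨ Literature.MathematicalPhysics.QuantumFieldTheory.Site.shift e.1 e.2 = x ∨
              e.1 = y ∨ Literature.MathematicalPhysics.QuantumFieldTheory.Site.shift e.1 e.2 = y) then W e else U e)))
          ∂(MeasureTheory.Measure.pi fun _ : Literature.MathematicalPhysics.QuantumFieldTheory.Edge 4 L =>
            Literature.MathematicalPhysics.QuantumFieldTheory.haarProbability
              (Matrix.specialUnitaryGroup (Fin 3) ℂ))) :=
      div_nonneg (MeasureTheory.integral_nonneg fun W => mul_nonneg (norm_nonneg _) (Real.exp_pos _).le)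
        (MeasureTheory.integral_nonneg fun W => (Real.exp_pos _).le)
    exact mul_le_mul_of_nonneg_right (mul_le_mul_of_nonneg_left hp hC.le) hM0
  · calc C * ε ^ c = C * 1 * ε ^ c := by ring
      _ ≤ C * (1 + β) ^ (max p 0) * ε ^ c := by
        gcongr

/-! ## §4.2  The structural kernel theorem at `m = 0` (statement; proof on paper in the docblock) -/

/-- **Kernel of the massless `r = 1` Wilson–Dirac operator.**  For every torus side `L`, every
`SU(3)` configuration `U` and every `ψ`: `D_W(U; m = 0, r = 1) ψ = 0` iff `ψ` is covariantly
constant, `ρ(U(x,μ)) ψ(x+μ̂, ·, α) = ψ(x, ·, α)` for all sites `x`, directions `μ` and spins `α`.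
(Paper proof in §4.2 of the module docblock: `Re⟨ψ, Dψ⟩ = 4‖ψ‖² − Σ_μ Re Σ_x ⟨ψ(x), U ψ(x+μ)⟩`,
Cauchy–Schwarz, hermiticity of `γ_μ`, unitarity of `U`.)  Consequence used in §4.3: at `m = 0`,
`‖det diracMatrix‖ = 0` iff the configuration admits a parallel colour section.  PROVED by
this seat (§7.1 `kerWilsonDiracMassless_holds`, tree file `Negative/MasslessKernel.lean`, p72940:
`D_W = 4 − Σ_μ W_μ` with four isometries, equality in the triangle inequality, chiral
projections). -/
def KerWilsonDiracMassless : Prop :=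
  open Literature.MathematicalPhysics.QuantumFieldTheory Literature.MathematicalPhysics.QuantumLattice
    Literature.Probability.LatticeModels in
  ∀ (L : ℕ) [NeZero L] (U : GaugeConfig 4 L (Matrix.specialUnitaryGroup (Fin 3) ℂ))
    (ψ : TorusSite 4 L × Fin 3 × Fin 4 → ℂ),
    (wilsonDirac (fundamentalRep (Fin 3)) U 0 1).mulVec ψ = 0 ↔
      ∀ (x : TorusSite 4 L) (μ : Fin 4) (a : Fin 3) (α : Fin 4),
        ∑ b : Fin 3, (fundamentalRep (Fin 3) (U (x, μ))) a b * ψ (Site.shift x μ, b, α) = ψ (x, a, α)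

/-! ## §3  Clause (b) alone falls under the twin-well hypothesis -/

/-- Local, byte-identical copy of the tree hypothesis
`Summit.QuantumFields.QCD.Theorems.TiltedFlatnessTwinWell` (the pinned refutation module cannot be
imported after the rev-4 restate, see the STATUS paragraph): the static twin-well kernel. -/
def TwinWell : Prop :=
  open MeasureTheory Set Literature.MathematicalPhysics.QuantumFieldTheory Literature.MathematicalPhysics.QuantumLattice
    Literature.Probability.LatticeModels in
  ∃ (Nf : ℕ) (mq : Fin Nf → ℝ) (_ : ∀ f, -2 ≤ mq f ∧ mq f ≤ 2) (L : ℕ) (_ : NeZero L)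
    (_ : 4 ≤ L) (U : GaugeConfig 4 L (Matrix.specialUnitaryGroup (Fin 3) ℂ))
    (x y : TorusSite 4 L)
    (O₁ O₂ : Set (GaugeConfig 4 L (Matrix.specialUnitaryGroup (Fin 3) ℂ)))
    (Φ : GaugeConfig 4 L (Matrix.specialUnitaryGroup (Fin 3) ℂ) →
      GaugeConfig 4 L (Matrix.specialUnitaryGroup (Fin 3) ℂ)),
    let star : Edge 4 L → Prop :=
      fun e => e.1 = x ∨ Site.shift e.1 e.2 = x ∨ e.1 = y ∨ Site.shift e.1 e.2 = y
    let refit : GaugeConfig 4 L (Matrix.specialUnitaryGroup (Fin 3) ℂ) →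
        GaugeConfig 4 L (Matrix.specialUnitaryGroup (Fin 3) ℂ) :=
      fun W e => if star e then W e else U e
    let F : GaugeConfig 4 L (Matrix.specialUnitaryGroup (Fin 3) ℂ) → ℝ :=
      fun W => ‖(diracMatrix (refit W) mq).det‖
    let S : GaugeConfig 4 L (Matrix.specialUnitaryGroup (Fin 3) ℂ) → ℝ :=
      fun W => wilsonAction (fundamentalRep (Fin 3)) (refit W)
    let haar : Measure (GaugeConfig 4 L (Matrix.specialUnitaryGroup (Fin 3) ℂ)) :=
      Measure.pi fun _ => haarProbability (Matrix.specialUnitaryGroup (Fin 3) ℂ)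
    IsClosed O₁ ∧ O₁.Nonempty ∧ Continuous Φ ∧ (∀ W, Φ (Φ W) = W) ∧
      MeasurePreserving Φ haar haar ∧ (∀ W, S (Φ W) = S W) ∧ MapsTo Φ O₁ O₂ ∧ MapsTo Φ O₂ O₁ ∧
      (∀ W, (∀ W', S W ≤ S W') → W ∈ O₁ ∪ O₂) ∧ (∀ W ∈ O₁, F W = 0) ∧ (∀ W ∈ O₂, 0 < F W)

/-- Under the twin-well hypothesis clause (b) ALONE (`SmallBallClause`) of the rev-3 text is false —
the landed conditional refutation never uses clause (a).  Same proof as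
`PauliWegnerSeaTiltedFlatness_refuted` (p71372), reading (b) directly, on the statement-independent
support `TiltedFlatnessNegative.small_ball_floor` (p71023). -/
theorem twinWell_refutes_smallBallClause (h : TwinWell) : ¬ SmallBallClause := by
  open MeasureTheory Literature.MathematicalPhysics.QuantumFieldTheory
    Literature.MathematicalPhysics.QuantumLattice Literature.Probability.LatticeModels
    Summit.QuantumFields.QCD.Theorems.TiltedFlatnessNegative in
  rintro hSB
  obtain ⟨Nf, mq, hmq, L, hL0, hL4, U, x, y, O₁, O₂, Φ, hO₁, hne, hΦc, hΦi, hΦμ, hΦS, h12, h21,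
    hargmin, hF1, hF2⟩ := h
  obtain ⟨C, c, hC, hc, H⟩ := hSB Nf
  set ε : ℝ := (1 / (8 * C)) ^ c⁻¹ with hε
  have hεpos : 0 < ε := Real.rpow_pos_of_pos (by positivity) _
  have hCε : C * ε ^ c = 1 / 8 := by
    rw [hε, Real.rpow_inv_rpow (by positivity) hc.ne']
    field_simp
  haveI : (Measure.pi fun _ : Edge 4 L =>
      haarProbability (Matrix.specialUnitaryGroup (Fin 3) ℂ)).IsOpenPosMeasure := by
    unfold haarProbability; infer_instance
  have hrefit : Continuous (fun W : GaugeConfig 4 L (Matrix.specialUnitaryGroup (Fin 3) ℂ) =>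
      fun e : Edge 4 L =>
        if (e.1 = x ∨ Site.shift e.1 e.2 = x ∨ e.1 = y ∨ Site.shift e.1 e.2 = y) then W e
        else U e) := by
    refine continuous_pi fun e => ?_
    by_cases h : (e.1 = x ∨ Site.shift e.1 e.2 = x ∨ e.1 = y ∨ Site.shift e.1 e.2 = y)
    · simp only [if_pos h]; exact continuous_apply e
    · simp only [if_neg h]; exact continuous_const
  obtain ⟨β, hβ0, hM, hquarter⟩ := small_ball_floor
    (Measure.pi fun _ : Edge 4 L => haarProbability (Matrix.specialUnitaryGroup (Fin 3) ℂ))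
    ((continuous_wilsonAction (fundamentalRep (Fin 3)) (continuous_fundamentalRep (Fin 3))).comp
      hrefit)
    (continuous_norm.comp ((Summit.QuantumFields.QCD.Theorems.TiltedFlatnessNegative.continuous_diracMatrix
      mq).comp hrefit).matrix_det)
    (fun W => norm_nonneg _) hO₁ hne hΦc hΦi hΦμ hΦS h12 h21 hargmin hF1 hF2 hεpos
  have hb := H β hβ0 mq hmq L hL4 U x y
  have h14 : (1 / 4 : ℝ) ≤ C * ε ^ c := hquarter.trans (hb hM ε hεpos)
  rw [hCε] at h14
  norm_num at h14


/-! ## §7  Load-bearing analysis of `C′` in Lean (item 14070, this seat) -/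

/-! ### §7.1  The massless kernel theorem (was the near-miss of §4.2) -/

/-- `KerWilsonDiracMassless` HOLDS: the kernel of `D_W(U; m = 0, r = 1)` is exactly the space of
parallel colour fields (tree theorem `wilsonDirac_massless_mulVec_eq_zero_iff'`,
`Theorems/TiltedFlatness/Negative/MasslessKernel.lean`, p72940). -/
theorem kerWilsonDiracMassless_holds : KerWilsonDiracMassless := by
  intro L _ U ψ
  exact Summit.QuantumFields.QCD.Theorems.TiltedFlatnessNegative.wilsonDirac_massless_mulVec_eq_zero_iff'
    (Literature.MathematicalPhysics.QuantumLattice.fundamentalRep (Fin 3))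
    Literature.MathematicalPhysics.QuantumLattice.fundamentalRep_mem_unitaryGroup U ψ

/-! ### §7.2  The loss in clause (a) is necessary -/

/-- Clause (a) of `C′` with loss exponent `p = 0`: β-UNIFORM relative flatness
`F(W₀) ≤ C · M_β` (everything else verbatim).  FALSE (`not_flatnessClauseUniform`). -/
def FlatnessClauseUniform : Prop :=
  open MeasureTheory Literature.MathematicalPhysics.QuantumFieldTheory
    Literature.MathematicalPhysics.QuantumLattice Literature.Probability.LatticeModels in
  ∀ Nf : ℕ, ∃ C : ℝ, 0 < C ∧ ∀ β : ℝ, 0 ≤ β → ∀ mq : Fin Nf → ℝ,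
    (∀ f, -2 ≤ mq f ∧ mq f ≤ 2) → ∀ (L : ℕ) [NeZero L], 4 ≤ L →
    ∀ (U : GaugeConfig 4 L (Matrix.specialUnitaryGroup (Fin 3) ℂ)) (x y : TorusSite 4 L),
    let star : Edge 4 L → Prop := fun e =>
      e.1 = x ∨ Site.shift e.1 e.2 = x ∨ e.1 = y ∨ Site.shift e.1 e.2 = y
    let refit : GaugeConfig 4 L (Matrix.specialUnitaryGroup (Fin 3) ℂ) →
        GaugeConfig 4 L (Matrix.specialUnitaryGroup (Fin 3) ℂ) :=
      fun W e => if star e then W e else U e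
    let F : GaugeConfig 4 L (Matrix.specialUnitaryGroup (Fin 3) ℂ) → ℝ :=
      fun W => ‖(diracMatrix (refit W) mq).det‖
    let wt : GaugeConfig 4 L (Matrix.specialUnitaryGroup (Fin 3) ℂ) → ℝ :=
      fun W => Real.exp (-(β * wilsonAction (fundamentalRep (Fin 3)) (refit W)))
    let haar : MeasureTheory.Measure (GaugeConfig 4 L (Matrix.specialUnitaryGroup (Fin 3) ℂ)) :=
      MeasureTheory.Measure.pi fun _ => haarProbability (Matrix.specialUnitaryGroup (Fin 3) ℂ)
    let Z : ℝ := ∫ W, wt W ∂haar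
    let M : ℝ := (∫ W, F W * wt W ∂haar) / Z
    ∀ W₀ : GaugeConfig 4 L (Matrix.specialUnitaryGroup (Fin 3) ℂ), F W₀ ≤ C * M

/-- **Clause (a) needs its loss**: β-uniform relative flatness is false (tree theorem
`not_flatnessClause_uniform`, `Theorems/TiltedFlatness/Negative/FlatnessNeedsLoss.lean`).
Witness: `N_f = 1`, `m = 0`, `L = 4`, `U ≡ 1`, `x = y = 0`; `F ≡ 0` on the minimisers of the star
action (flat ⇒ pure gauge at `0` ⇒ parallel field ⇒ massless kernel), `F > 0` at the single twist
`diag(i,i,−1)` of the link `(0, ê₀)`, Laplace concentration ⇒ `M_β → 0`. -/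
theorem not_flatnessClauseUniform : ¬ FlatnessClauseUniform :=
  Summit.QuantumFields.QCD.Theorems.TiltedFlatnessNegative.not_flatnessClause_uniform

/-- `C′` WITH THE LOSS DROPPED FROM CLAUSE (a) only ((b′) keeps its loss): the natural
"half-way" strengthening between rev 3 and rev 4.  FALSE (`not_tiltedFlatnessNoLossA`). -/
def TiltedFlatnessNoLossA : Prop :=
  open MeasureTheory Literature.MathematicalPhysics.QuantumFieldTheory
    Literature.MathematicalPhysics.QuantumLattice Literature.Probability.LatticeModels in
  ∀ Nf : ℕ, ∃ C p c : ℝ, 0 < C ∧ 0 < c ∧ ∀ β : ℝ, 0 ≤ β → ∀ mq : Fin Nf → ℝ,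
    (∀ f, -2 ≤ mq f ∧ mq f ≤ 2) → ∀ (L : ℕ) [NeZero L], 4 ≤ L →
    ∀ (U : GaugeConfig 4 L (Matrix.specialUnitaryGroup (Fin 3) ℂ)) (x y : TorusSite 4 L),
    let star : Edge 4 L → Prop := fun e =>
      e.1 = x ∨ Site.shift e.1 e.2 = x ∨ e.1 = y ∨ Site.shift e.1 e.2 = y
    let refit : GaugeConfig 4 L (Matrix.specialUnitaryGroup (Fin 3) ℂ) →
        GaugeConfig 4 L (Matrix.specialUnitaryGroup (Fin 3) ℂ) :=
      fun W e => if star e then W e else U e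
    let F : GaugeConfig 4 L (Matrix.specialUnitaryGroup (Fin 3) ℂ) → ℝ :=
      fun W => ‖(diracMatrix (refit W) mq).det‖
    let wt : GaugeConfig 4 L (Matrix.specialUnitaryGroup (Fin 3) ℂ) → ℝ :=
      fun W => Real.exp (-(β * wilsonAction (fundamentalRep (Fin 3)) (refit W)))
    let haar : MeasureTheory.Measure (GaugeConfig 4 L (Matrix.specialUnitaryGroup (Fin 3) ℂ)) :=
      MeasureTheory.Measure.pi fun _ => haarProbability (Matrix.specialUnitaryGroup (Fin 3) ℂ)
    let Z : ℝ := ∫ W, wt W ∂haar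
    let M : ℝ := (∫ W, F W * wt W ∂haar) / Z
    (∀ W₀ : GaugeConfig 4 L (Matrix.specialUnitaryGroup (Fin 3) ℂ), F W₀ ≤ C * M) ∧
    (0 < M → ∀ ε : ℝ, 0 < ε →
      (∫ W, (if F W ≤ ε * M then (1 : ℝ) else 0) * wt W ∂haar) / Z ≤ C * (1 + β) ^ p * ε ^ c)

/-- `C′` without the loss in (a) is false (it contains `FlatnessClauseUniform`). -/
theorem not_tiltedFlatnessNoLossA : ¬ TiltedFlatnessNoLossA := fun h =>
  not_flatnessClauseUniform fun Nf => by
    obtain ⟨C, p, c, hC, -, H⟩ := h Nf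
    exact ⟨C, hC, fun β hβ mq hmq L _ hL U x y W₀ => (H β hβ mq hmq L hL U x y).1 W₀⟩

/-- Bookkeeping: `TiltedFlatnessNoLossA` would have implied the current crux (take the same
`C, p, c`; `1 ≤ (1+β)^{max p 0}`).  Recorded so the planner sees the exact position of `C′`
between the refuted no-loss variants and the (believed true) lossy statement: BOTH losses are
needed, neither clause can be sharpened back to rev 3. -/
theorem tiltedFlatness_of_noLossA (h : TiltedFlatnessNoLossA) : TiltedFlatness := by
  intro Nf
  obtain ⟨C, p, c, hC, hc, H⟩ := h Nf
  refine ⟨C, max p 0, c, hC, hc, fun β hβ mq hmq L _ hL U x y => ?_⟩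
  obtain ⟨ha, hb⟩ := H β hβ mq hmq L hL U x y
  have h1 : (1 : ℝ) ≤ (1 + β) ^ (max p 0) := Real.one_le_rpow (by linarith) (le_max_right _ _)
  have hp : (1 + β) ^ p ≤ (1 + β) ^ (max p 0) :=
    Real.rpow_le_rpow_of_exponent_le (by linarith) (le_max_left _ _)
  have key : ∀ M : ℝ, 0 ≤ M → C * M ≤ C * (1 + β) ^ (max p 0) * M := fun M hM => by
    have := mul_le_mul_of_nonneg_right h1 (mul_nonneg hC.le hM)
    linarith [this]
  refine ⟨fun W₀ => (ha W₀).trans (key _ (div_nonneg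
      (MeasureTheory.integral_nonneg fun W => mul_nonneg (norm_nonneg _) (Real.exp_pos _).le)
      (MeasureTheory.integral_nonneg fun W => (Real.exp_pos _).le))), fun hM ε hε => ?_⟩
  calc _ ≤ C * (1 + β) ^ p * ε ^ c := hb hM ε hε
    _ = (1 + β) ^ p * (C * ε ^ c) := by ring
    _ ≤ (1 + β) ^ (max p 0) * (C * ε ^ c) :=
        mul_le_mul_of_nonneg_right hp (mul_nonneg hC.le (Real.rpow_nonneg hε.le _))
    _ = C * (1 + β) ^ (max p 0) * ε ^ c := by ring

/-! ### §7.3  Hypotheses that are NOT load-bearing (information for the provers)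

* Mass box `mq ∈ [−2,2]^{N_f}`: for fixed `N_f` the function `W ↦ det diracMatrix (refit W) mq`
  ranges, for ALL real mass tuples, in one finite-dimensional space of star-link polynomials (the
  mass enters the coefficients only), so every constant obtained from that space is automatically
  mass-uniform.  `TiltedFlatnessAllMasses` below is therefore believed EQUIVALENT to `C′`; only
  the trivial direction is a theorem.
* `4 ≤ L`: for `L ∈ {1,2,3}` the star wraps around the torus and the polynomial space changes,
  but there are finitely many such cases, each finite-dimensional: constants `max` over them.
* `0 ≤ β`: for `β < 0` the tilt concentrates on the MAXIMA of the star action; the untilt and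
  vanishing-order arguments are symmetric (with `|β|`), only `(1+β)^p` must read `(1+|β|)^p` and
  `rpow` of a negative base is junk — a hygiene restriction, not a mathematical one. -/

/-- `C′` for ALL real mass tuples (the box `[−2,2]^{N_f}` dropped).  Believed equivalent to `C′`
(mass-independence of the polynomial space); trivially stronger. -/
def TiltedFlatnessAllMasses : Prop :=
  open MeasureTheory Literature.MathematicalPhysics.QuantumFieldTheory
    Literature.MathematicalPhysics.QuantumLattice Literature.Probability.LatticeModels in
  ∀ Nf : ℕ, ∃ C p c : ℝ, 0 < C ∧ 0 < c ∧ ∀ β : ℝ, 0 ≤ β → ∀ mq : Fin Nf → ℝ,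
    ∀ (L : ℕ) [NeZero L], 4 ≤ L →
    ∀ (U : GaugeConfig 4 L (Matrix.specialUnitaryGroup (Fin 3) ℂ)) (x y : TorusSite 4 L),
    let star : Edge 4 L → Prop := fun e =>
      e.1 = x ∨ Site.shift e.1 e.2 = x ∨ e.1 = y ∨ Site.shift e.1 e.2 = y
    let refit : GaugeConfig 4 L (Matrix.specialUnitaryGroup (Fin 3) ℂ) →
        GaugeConfig 4 L (Matrix.specialUnitaryGroup (Fin 3) ℂ) :=
      fun W e => if star e then W e else U e
    let F : GaugeConfig 4 L (Matrix.specialUnitaryGroup (Fin 3) ℂ) → ℝ :=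
      fun W => ‖(diracMatrix (refit W) mq).det‖
    let wt : GaugeConfig 4 L (Matrix.specialUnitaryGroup (Fin 3) ℂ) → ℝ :=
      fun W => Real.exp (-(β * wilsonAction (fundamentalRep (Fin 3)) (refit W)))
    let haar : MeasureTheory.Measure (GaugeConfig 4 L (Matrix.specialUnitaryGroup (Fin 3) ℂ)) :=
      MeasureTheory.Measure.pi fun _ => haarProbability (Matrix.specialUnitaryGroup (Fin 3) ℂ)
    let Z : ℝ := ∫ W, wt W ∂haar
    let M : ℝ := (∫ W, F W * wt W ∂haar) / Z
    (∀ W₀ : GaugeConfig 4 L (Matrix.specialUnitaryGroup (Fin 3) ℂ), F W₀ ≤ C * (1 + β) ^ p * M) ∧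
    (0 < M → ∀ ε : ℝ, 0 < ε →
      (∫ W, (if F W ≤ ε * M then (1 : ℝ) else 0) * wt W ∂haar) / Z ≤ C * (1 + β) ^ p * ε ^ c)

/-- The all-masses version trivially implies the crux. -/
theorem tiltedFlatness_of_allMasses (h : TiltedFlatnessAllMasses) : TiltedFlatness := by
  intro Nf
  obtain ⟨C, p, c, hC, hc, H⟩ := h Nf
  exact ⟨C, p, c, hC, hc, fun β hβ mq _ L _ hL U x y => H β hβ mq L hL U x y⟩

/-! ## §8  Why `C′` resists: the soft proof architecture (for the provers)

Write `n ≤ 16` for the number of star links, `G = SU(3)^n` with product Haar `λ`, and for fixed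
`N_f` let `V` be the (finite-dimensional, `L`-, `U`-, `mq`-independent) real vector space of
functions `G → ℂ` that are polynomial of bidegree `≤ (12 N_f, 12 N_f)` in the entries of each link
and their conjugates (Pauli even gives `(6N_f, 6N_f)`).  For every admissible datum,
`P := (W|star ↦ det diracMatrix (refit W) mq) ∈ V` and `F = |P|`; `S := W ↦ wilsonAction (refit W)`
is `const(U) + S_loc(W|star)` with `S_loc` `K`-Lipschitz on `G`, `K` absolute.

* (P1, UNTILT) `Z ≥ e^{-β S_min} e^{-1} λ(B(W*, 1/(K(1+β)))) ≥ e^{-β S_min} e^{-1} c_n (K(1+β))^{-8n}`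
  and `wt ≤ e^{-β S_min}`, so `dν_β/dλ ≤ e c_n^{-1} K^{8n} (1+β)^{8n}`; and
  `M_β ≥ e^{-1} ∫_{B(W*, 1/(K(1+β)))} F dλ` (`W*` any minimiser of `S_loc`).
* (P2, FINITE UNIFORM VANISHING ORDER) on the compact set `S(V) × G` (`S(V)` = sup-norm unit
  sphere) the order of vanishing `ord_g(P)` is upper semicontinuous and finite everywhere (`P ≢ 0`
  is real-analytic on the CONNECTED group), hence bounded by some `k₀ − 1 = k₀(N_f) − 1`; with
  left-invariant normal coordinates the Taylor data give, uniformly,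
  (L1) `∫_{B(g,r)} |P| dλ ≥ c r^{8n + k₀ − 1} ‖P‖_∞` for `r ≤ 1`, and
  (SB) `λ(|P| ≤ ε ‖P‖_∞) ≤ C ε^{1/(k₀−1)}` (van der Corput sublevel lemma along the direction of a
  non-vanishing derivative of order `< k₀`, integrated over a finite atlas).
* (a) = P1 + L1 with `p = 8n + k₀ − 1`; (b′) = P1 + SB with `p = 8n`, `c = 1/(k₀ − 1)`, using
  `{F ≤ εM_β} ⊆ {F ≤ ε‖F‖_∞}`.
No quantitative Remez/Brudnyi input is needed; the only non-elementary step is the u.s.c. of the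
vanishing order on an analytic family.  The two no-loss refutations of §7.2/§3 show `p > 0` is
needed in BOTH clauses, and `not_tiltedFlatness_uniform_in_Nf` (§9) shows `k₀` must grow with
`N_f`. -/

/-! ## §9  Natural strengthenings: refuted / open -/

/-- `C′` with constants UNIFORM IN `N_f` (`∃ C p c ∀ N_f …`).  FALSE:
`not_tiltedFlatnessUniformInNf` (tree theorem `not_tiltedFlatness_uniform_in_Nf`,
`Theorems/TiltedFlatness/Negative/NfDependence.lean`; (b′) at `β = 0` with `F = G^{N_f}` on the
free one-star fibre). -/
def TiltedFlatnessUniformInNf : Prop :=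
  open MeasureTheory Literature.MathematicalPhysics.QuantumFieldTheory
    Literature.MathematicalPhysics.QuantumLattice Literature.Probability.LatticeModels in
  ∃ C p c : ℝ, 0 < C ∧ 0 < c ∧ ∀ (Nf : ℕ) (β : ℝ), 0 ≤ β → ∀ mq : Fin Nf → ℝ,
    (∀ f, -2 ≤ mq f ∧ mq f ≤ 2) → ∀ (L : ℕ) [NeZero L], 4 ≤ L →
    ∀ (U : GaugeConfig 4 L (Matrix.specialUnitaryGroup (Fin 3) ℂ)) (x y : TorusSite 4 L),
    let star : Edge 4 L → Prop := fun e =>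
      e.1 = x ∨ Site.shift e.1 e.2 = x ∨ e.1 = y ∨ Site.shift e.1 e.2 = y
    let refit : GaugeConfig 4 L (Matrix.specialUnitaryGroup (Fin 3) ℂ) →
        GaugeConfig 4 L (Matrix.specialUnitaryGroup (Fin 3) ℂ) :=
      fun W e => if star e then W e else U e
    let F : GaugeConfig 4 L (Matrix.specialUnitaryGroup (Fin 3) ℂ) → ℝ :=
      fun W => ‖(diracMatrix (refit W) mq).det‖
    let wt : GaugeConfig 4 L (Matrix.specialUnitaryGroup (Fin 3) ℂ) → ℝ :=
      fun W => Real.exp (-(β * wilsonAction (fundamentalRep (Fin 3)) (refit W)))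
    let haar : MeasureTheory.Measure (GaugeConfig 4 L (Matrix.specialUnitaryGroup (Fin 3) ℂ)) :=
      MeasureTheory.Measure.pi fun _ => haarProbability (Matrix.specialUnitaryGroup (Fin 3) ℂ)
    let Z : ℝ := ∫ W, wt W ∂haar
    let M : ℝ := (∫ W, F W * wt W ∂haar) / Z
    (∀ W₀ : GaugeConfig 4 L (Matrix.specialUnitaryGroup (Fin 3) ℂ),
      F W₀ ≤ C * (1 + β) ^ p * M) ∧
    (0 < M → ∀ ε : ℝ, 0 < ε →
      (∫ W, (if F W ≤ ε * M then (1 : ℝ) else 0) * wt W ∂haar) / Z ≤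
        C * (1 + β) ^ p * ε ^ c)

/-- **The constants must depend on `N_f`.** -/
theorem not_tiltedFlatnessUniformInNf : ¬ TiltedFlatnessUniformInNf :=
  Summit.QuantumFields.QCD.Theorems.TiltedFlatnessNegative.not_tiltedFlatness_uniform_in_Nf

/-- `N_f`-uniform constants would have implied the crux (bookkeeping of the implication lattice:
`UniformInNf ⇒ C′`, `NoLossA ⇒ C′`, `Rev3 ⇒ C′`; all three antecedents are now refuted or
conditionally refuted, `C′` stands). -/
theorem tiltedFlatness_of_uniformInNf (h : TiltedFlatnessUniformInNf) : TiltedFlatness := by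
  obtain ⟨C, p, c, hC, hc, H⟩ := h
  exact fun Nf => ⟨C, p, c, hC, hc, fun β hβ mq hmq L _ hL U x y => H Nf β hβ mq hmq L hL U x y⟩

/-! ### Open (next attacks, for the record) and pre-assessment of the filed line

* `C′` itself: no attack left that is not excluded by §8; the seat's standing recommendation to the
  planner is to KEEP rev 4 and to let the provers follow §8 (first Lean-checkable pieces: the untilt
  sandwich P1 — pure measure theory on the compact group, cf. `Barriers/UnitaryHaarSmallBall` for
  the Haar-ball volume — and the finite-dimensionality of `V`, cf. support item `PauliBandLimit`).
* LINE `Lines/R1DensityReduction.lean` (crux-plan, read 2026-08-16T04Z; its reduction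
  `tiltedFlatness_of_R1_density : HaarRelativeSmallBalls → TiltDensityBound → TiltedFlatness` is
  PROVED there, so the crux is now formally `R1 ∧ density bound`).  Disprover's pre-assessment of the
  future stubs, all BELIEVED TRUE (no target killed): `TiltDensityBound` = §8 (P1) with absolute
  `C, p` (`p = 8n ≤ 128`; uniform in the outside because outside links enter the star plaquettes as
  fixed unitary factors, trace-Lipschitz uniformly); `HaarRelativeSmallBalls` ⊆ §8 (SB) since
  `{F ≤ εF(W₀)} ⊆ {F ≤ ε sup F}`; `NegMomentCircle` (Hölder over `≤ m` root factors, `cm < 1`) and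
  `NegMomentTorus` (slice induction) hold — the Lean proof of the latter must treat the finitely many
  slices `θ_d` with `P(·, e^{iθ_d}) ≡ 0` (null set) and reference slices with `P(e^{iθ₀'}, ·) ≡ 0`
  (numerator vanishes) explicitly; `SU3SurjectiveWord` is the generalized-Euler-angle surjectivity
  (degree `2` only through `e^{iφ√3λ₈}`).  The free-star fibre of §7.2 is a cheap REGRESSION TEST for
  any proposed constants: there `F` has an `8`-dimensional zero orbit inside `SU(3)^8`.
* Sharper negative facts one could still certify: the EXACT polynomial rate `M_β ≍ (1+β)^{-κ}` on
  the free-star fibre (tightness of `p` in (a)); `c ≤ 1/2` in (b′) from a fibre where `F` vanishes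
  quadratically; both need quantitative Laplace asymptotics on `SU(3)^8`, not attempted. -/


/-! ## §10  (gen 2, 2026-08-16) TARGETS: the seven registered stubs of the picked line `circle-transport` (r2b)

Payload `targets`/`stuck_stubs` were empty at arming (lead cycle 0); the registered stubs of skeleton
`a15f8fe3aff9` are taken as targets.  Each was re-derived on paper AND read in Lean semantics for junk.

### §10.0  Verdict table (all: believed TRUE as stated — no `stub_false`)

| stub | verdict / why true | Lean corners the proof must treat | nearest in-tree engine |
|---|---|---|---|
| `stub_bandLimit` (`BandLimit T`, two-sided, degree `48N_f`) | TRUE: entries of `D_W` are affine in `U_e` and `U_e⁻¹ = U_e†`; with `U_e = A T(s) B` the coefficient matrix of `e^{is}` is `(A E₀₀ B) ⊗ (1−γ_μ)/2 ⊕ (B⁻¹E₁₁A⁻¹) ⊗ (1+γ_μ)/2` on disjoint row blocks (`e.1 ≠ shift e.1 e.2` for `L ≥ 2`), rank `≤ 4` (crudely `≤ 24` rows) per flavour ⇒ `det` has Laurent bidegree `≤ (4,4)` per flavour, `|det|² ≤ 8N_f ≤ 48N_f`; `N_f = 0`: `det = 1`, degree `0` | `diracMatrix` is `reindex`ed and flavour-block-diagonal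 (`if v.1 = w.1`): needs `det_reindex_self` + block determinant = product over flavours (then `trigPoly_mul`, §10.1); the `ρ(U)⁻¹` in `wilsonDirac` is `Matrix.inv` of a unitary — rewrite to `star` first | `PauliBandLimit.det_add_smul_add_smul_of_rank_le` (LANDED), `trigPoly_mul`/`trigPoly_pow` (§10.1) |
| `stub_actionLipschitz` | TRUE with `K = 12`: the edge lies in exactly `6` plaquettes for `L ≥ 2` (never twice in one plaquette), each term `3 − Re tr(X A T(s) B Y)` has `s`-derivative `Re tr(Q T′(s))`, `|·| ≤ |Q₀₀|+|Q₁₁| ≤ 2` (`Q` unitary); attained (drefute toy: `12.000` at `L = 2, 4`) | only `∃ K`; group inverse `(A T s B)⁻¹` inside `plaquetteHolonomy` — use `T(s)⁻¹ = T(−s)` (from `IsDiagCircle`) | `wilsonAction` is a `Finset.sum` over `Plaquette 4 L`; split off the `≤ 12` summands mentioning `e` |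
| `stub_eulerWord` | TRUE, `d = 9` | `IsDiagCircle T` pins `T = diagCircle` (drefute P1); the word is `List.ofFn … |>.prod` (order!) | `FiniteSignBudgetAtTheSchemeVolume.stub_su3CircleWord` (LANDED: `A = P₁₂R₁₂P₁₂·P₀₁R₀₁P₀₁·P₁₂R₁₂P₁₂`); remaining: `P₁₂(θ) = V T(θ) V⁻¹` (`V` = cyclic permutation, det `+1`), `R₀₁(θ) = V₀ T(θ) V₀⁻¹`, `R₁₂(θ) = V₁ T(θ) V₁⁻¹` (`V₀ = exp(−iπσ_x/4)` in the block: `R(θ) = exp(−iθσ_y)`, `σ_y = V₀ σ_z V₀⁻¹`) |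
| `stub_circleEngine`.1 (Nikolskii, constant `2D+1`) | TRUE: `a_k = ⨍ f e^{−ik·}`, `|a_k| ≤ ⨍|f| = ⨍ f`, `f ≤ Σ|a_k| ≤ (2D+1)⨍f` (sharp constant is `D+1`, Fejér; `2D+1` needs only orthogonality `∫_{−π}^{π} e^{int} = 0`, `n ≠ 0`: `integral_exp_mul_complex`) | set integral on `Icc` vs interval integral (`integral_Icc_eq_integral_Ioc`, `intervalIntegral.integral_of_le`); `f` real-valued but `a` complex | Mathlib `fourierCoeff`/`AddCircle` is an alternative but the raw `Icc` form is shorter |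
| `stub_circleEngine`.2 (`CircleSmallBall`) | TRUE with `c = 1/(2D)` (`C ≥ 2π` for `ε ≥ 1`; `D = 0`: `f` constant); **`c > 1/(2D)` is IMPOSSIBLE: `not_circleSmallBall_exponent_gt` (§10.1, CERTIFIED)** | `0 < ∫ f` excludes `f ≡ 0` only; `{f ≤ ε⨍f}` for `ε ≥ 1` may be everything | `CarberyWright.remez_weak` (PROVED) after `u = tan(t/2)`, or Turán–Nazarov (`Literature/Analysis/Approximation/TuranNazarov.lean`, vendored fact) |
| `stub_torusSmallBalls` (`Nikolskii → CircleSmallBall → TorusSmallBalls`) | TRUE, `c = 1/(2Dm)` by the Remez-form slice induction (`sup_{T^m}|q| ≤ Φ_m(|E|) sup_E |q|`, `Φ_m(ε) = Φ_{m−1}(ε/2)(2A/ε)^{2D}`); separately-trig-poly + nothing ⇒ jointly `𝒯_D^{⊗m}` (interpolate at `2D+1` nodes per variable; `Continuous q` is REDUNDANT); `c = 1/(2D)` exactly fails for `m ≥ 2` (log factor, drefute toy) but `c` is existential | `θ₀` is ANY point of `ℝ^m` (fine: `q` is `2π`-periodic in each variable, so `q θ₀` is attained in the cube); `m = 0`: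 cube `= univ` of volume `1` (checked: `Real.volume_Icc_pi`), `q` constant, forces `C ≥ 1`; `.toReal` of a finite measure | — |
| `stub_haarSmallBalls` (lead; `→ FibreSmallBalls T`) | TRUE: word coupling `Haar^E = Haar^E ∗ (word law)` coordinatewise on `range r` (right-invariance + Tonelli on the closed set `{(g,s) : F(g·w(s)) ≤ εF(W₀)}`), every word fibre reaches `W₀` on `range r` (surjectivity; `F` ignores the rest), pull-back `q_g(s) = F²(g·w(s))` is separately trig-poly of degree `≤ D` in each of `m = d·#range(r) ≤ dn` angles (each letter sits as `A T(s_j) B`), `{F ≤ εF(W₀)} = {F² ≤ ε²F(W₀)²}` ⇒ `C_{TSB}(ε²)^{c_{TSB}}/(2π)^m`; **the two-sidedness `A·T·B` is LOAD-BEARING: `not_fibreSmallBalls_oneSided` (§10.2, CERTIFIED)**; constants necessarily depend on `n` (§10.2, CERTIFIED) and on `D` (§10.1) | `r` non-injective (work per element of `range r`); `E = ∅`/`ι = ∅`: `F` constant, `{F ≤ εF W₀} = univ` iff `ε ≥ 1` ⇒ `C ≥ 1`; `W₀` need not be related to `W`; measurability: the sublevel set is closed (`Continuous F`) | `MeasureTheory.Measure.pi`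 right-invariance (`Pi.mulSingle`), `Measure.pi_pi`, `integral_fintype_prod_eq_prod` |
| `stub_circleUntilt` (`→ FibreDensity T`) | TRUE with `p = m = d·n` (**one-sided Lipschitz circles would NOT suffice: `not_fibreDensity_oneSided`, §10.2, CERTIFIED**), `C = e(2+2πKm)^m ∨ 1`: `Z ≥ e^{−β(S_min+δ)}·inf_g Leb_norm{s : S(g·w(s)) ≤ S_min+δ} ≥ e^{−βS_min−1} c_m (δ/K)^m` at `δ = 1/(1+β)` (every fibre reaches a global minimiser; per-angle `K`-Lipschitz; `T` is `2π`-periodic so angles live in the box), `e^{−βS(W)} ≤ e^{−βS_min}` | `K < 0` makes the hypothesis contradictory unless `ι = ∅` (then `S` is constant, ratio `= 1`): choose `C ≥ 1`, `p ≥ 0` uniformly; `K = 0` ⇒ `S` constant; minimiser exists (compact `E → SU3`, `S` continuous); `p : ℝ` is an `rpow` exponent, base `1+β ≥ 1` | `IsCompact.exists_isMinOn`, word coupling as above |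

Trunk/glue (`tiltedFlatness_of_R1_density`, `haarRelativeSmallBalls_of`, `tiltDensityBound_of`,
`cruxOfCircleTransport_holds`, `TiltedFlatness_of`) are kernel-checked in the skeleton; nothing to attack.
Crux-level corners re-checked this cycle: `(1+β)^p` at `β = −1`, `p > 0` is `0^p = 0` (so `0 ≤ β` is
rpow hygiene only, as noted in §7.3); nothing new on `C′` itself — the gen-1 analysis (§4, §6, §8) stands.
-/

section Gen2Targets

open MeasureTheory Set Real Finset Filter
open Literature.MathematicalPhysics.QuantumFieldTheory Literature.MathematicalPhysics.QuantumLattice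
  Literature.Probability.LatticeModels

/-! ### §10.1  The exponent of the 1-D engine must decay like `1/(2D)` (CERTIFIED; landing as
`Theorems/TiltedFlatness/Negative/CircleEngineExponent.lean`, same names in namespace
`Summit.QuantumFields.QCD.Theorems.TiltedFlatnessNegative`) -/

/-- Product of trigonometric polynomials of degrees `≤ D₁`, `≤ D₂` (literal stub shape) has degree `≤ D₁ + D₂`
(Cauchy product of coefficients).  Reusable by `stub_bandLimit` (`det diracMatrix = Π_f det D_W(m_f)`). -/
theorem trigPoly_mul {D₁ D₂ : ℕ} {F G : ℝ → ℂ}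
    (hF : ∃ a : ℤ → ℂ, ∀ t : ℝ, F t =
      ∑ k ∈ Finset.Icc (-(D₁ : ℤ)) D₁, a k * Complex.exp ((k : ℂ) * (t : ℂ) * Complex.I))
    (hG : ∃ b : ℤ → ℂ, ∀ t : ℝ, G t =
      ∑ k ∈ Finset.Icc (-(D₂ : ℤ)) D₂, b k * Complex.exp ((k : ℂ) * (t : ℂ) * Complex.I)) :
    ∃ c : ℤ → ℂ, ∀ t : ℝ, F t * G t =
      ∑ k ∈ Finset.Icc (-((D₁ + D₂ : ℕ) : ℤ)) ((D₁ + D₂ : ℕ) : ℤ),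
        c k * Complex.exp ((k : ℂ) * (t : ℂ) * Complex.I) := by
  obtain ⟨a, ha⟩ := hF
  obtain ⟨b, hb⟩ := hG
  refine ⟨fun k => ∑ j ∈ Finset.Icc (-(D₁ : ℤ)) D₁, ∑ l ∈ Finset.Icc (-(D₂ : ℤ)) D₂,
    if j + l = k then a j * b l else 0, fun t => ?_⟩
  set e : ℤ → ℂ := fun k => Complex.exp ((k : ℂ) * (t : ℂ) * Complex.I) with he
  have hee : ∀ j l : ℤ, e j * e l = e (j + l) := by
    intro j l
    simp only [he, ← Complex.exp_add]
    congr 1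
    push_cast
    ring
  rw [ha t, hb t, Finset.sum_mul_sum]
  symm
  calc ∑ k ∈ Finset.Icc (-((D₁ + D₂ : ℕ) : ℤ)) ((D₁ + D₂ : ℕ) : ℤ),
        (∑ j ∈ Finset.Icc (-(D₁ : ℤ)) D₁, ∑ l ∈ Finset.Icc (-(D₂ : ℤ)) D₂,
          if j + l = k then a j * b l else 0) * e k
      = ∑ k ∈ Finset.Icc (-((D₁ + D₂ : ℕ) : ℤ)) ((D₁ + D₂ : ℕ) : ℤ),
          ∑ j ∈ Finset.Icc (-(D₁ : ℤ)) D₁, ∑ l ∈ Finset.Icc (-(D₂ : ℤ)) D₂,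
            (if j + l = k then a j * b l * e k else 0) := by
        refine Finset.sum_congr rfl fun k _ => ?_
        rw [Finset.sum_mul]
        refine Finset.sum_congr rfl fun j _ => ?_
        rw [Finset.sum_mul]
        refine Finset.sum_congr rfl fun l _ => ?_
        split_ifs <;> simp
    _ = ∑ j ∈ Finset.Icc (-(D₁ : ℤ)) D₁, ∑ l ∈ Finset.Icc (-(D₂ : ℤ)) D₂,
          ∑ k ∈ Finset.Icc (-((D₁ + D₂ : ℕ) : ℤ)) ((D₁ + D₂ : ℕ) : ℤ),
            (if j + l = k then a j * b l * e k else 0) := by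
        rw [Finset.sum_comm]
        refine Finset.sum_congr rfl fun j _ => ?_
        rw [Finset.sum_comm]
    _ = ∑ j ∈ Finset.Icc (-(D₁ : ℤ)) D₁, ∑ l ∈ Finset.Icc (-(D₂ : ℤ)) D₂,
          a j * e j * (b l * e l) := by
        refine Finset.sum_congr rfl fun j hj => ?_
        refine Finset.sum_congr rfl fun l hl => ?_
        rw [Finset.sum_ite_eq]
        have hmem : j + l ∈ Finset.Icc (-((D₁ + D₂ : ℕ) : ℤ)) ((D₁ + D₂ : ℕ) : ℤ) := by
          rw [Finset.mem_Icc] at hj hl ⊢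
          push_cast
          omega
        rw [if_pos hmem, ← hee]
        ring

/-- Powers of a trigonometric polynomial of degree `≤ D` have degree `≤ n D`. -/
theorem trigPoly_pow {D : ℕ} {F : ℝ → ℂ}
    (hF : ∃ a : ℤ → ℂ, ∀ t : ℝ, F t =
      ∑ k ∈ Finset.Icc (-(D : ℤ)) D, a k * Complex.exp ((k : ℂ) * (t : ℂ) * Complex.I)) (n : ℕ) :
    ∃ c : ℤ → ℂ, ∀ t : ℝ, F t ^ n =
      ∑ k ∈ Finset.Icc (-((n * D : ℕ) : ℤ)) ((n * D : ℕ) : ℤ),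
        c k * Complex.exp ((k : ℂ) * (t : ℂ) * Complex.I) := by
  induction n with
  | zero =>
    refine ⟨fun k => if k = 0 then 1 else 0, fun t => ?_⟩
    simp
  | succ n ih =>
    obtain ⟨c, hc⟩ := trigPoly_mul ih hF
    refine ⟨c, fun t => ?_⟩
    rw [pow_succ, hc t]
    congr 2 <;> push_cast <;> ring

/-- `1 - cos t` as a trigonometric polynomial of degree `1`. -/
theorem one_sub_cos_trig :
    ∃ a : ℤ → ℂ, ∀ t : ℝ, (((1 - Real.cos t : ℝ)) : ℂ) =
      ∑ k ∈ Finset.Icc (-(1 : ℕ) : ℤ) (1 : ℕ), a k * Complex.exp ((k : ℂ) * (t : ℂ) * Complex.I) := by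
  refine ⟨fun k : ℤ => if k = 0 then (1 : ℂ) else -(1 / 2), fun t => ?_⟩
  have h : Finset.Icc (-(1 : ℕ) : ℤ) (1 : ℕ) = {-1, 0, 1} := by decide
  rw [h, Finset.sum_insert (by decide), Finset.sum_insert (by decide), Finset.sum_singleton]
  simp only [Complex.ofReal_sub, Complex.ofReal_one, Complex.ofReal_cos]
  rw [Complex.cos]
  push_cast
  simp only [zero_mul, Complex.exp_zero, neg_mul, one_mul]
  ring

/-- `(1 - cos t)^D` as a trigonometric polynomial of degree `D`. -/
theorem one_sub_cos_pow_trig (D : ℕ) :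
    ∃ a : ℤ → ℂ, ∀ t : ℝ, ((((1 - Real.cos t) ^ D : ℝ)) : ℂ) =
      ∑ k ∈ Finset.Icc (-(D : ℤ)) D, a k * Complex.exp ((k : ℂ) * (t : ℂ) * Complex.I) := by
  obtain ⟨c, hc⟩ := trigPoly_pow (F := fun t => (((1 - Real.cos t : ℝ)) : ℂ)) (D := 1)
    (by simpa using one_sub_cos_trig) D
  refine ⟨c, fun t => ?_⟩
  have := hc t
  simp only [mul_one] at this
  push_cast at this ⊢
  exact this

/-- `∫_{[-π,π]} (1 - cos)^D > 0`. -/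
theorem integral_one_sub_cos_pow_pos (D : ℕ) :
    0 < ∫ t in Set.Icc (-π) π, (1 - Real.cos t) ^ D := by
  have hcont : Continuous fun t : ℝ => (1 - Real.cos t) ^ D :=
    (continuous_const.sub Real.continuous_cos).pow D
  rw [setIntegral_pos_iff_support_of_nonneg_ae]
  · -- the support contains `(0, π]`
    have hsub : Set.Ioc 0 π ⊆ (Function.support fun t : ℝ => (1 - Real.cos t) ^ D) ∩ Set.Icc (-π) π := by
      intro t ht
      refine ⟨?_, ⟨by linarith [ht.1, Real.pi_pos], ht.2⟩⟩
      rw [Function.mem_support]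
      apply pow_ne_zero
      intro h0
      have hcos : Real.cos t = 1 := by linarith
      rw [Real.cos_eq_one_iff_of_lt_of_lt (by linarith [ht.1, Real.pi_pos]) (by linarith [ht.2, Real.pi_pos])]
        at hcos
      linarith [ht.1]
    calc (0 : ENNReal) < volume (Set.Ioc (0 : ℝ) π) := by
          rw [Real.volume_Ioc]; simpa using Real.pi_pos
      _ ≤ _ := measure_mono hsub
  · exact Filter.Eventually.of_forall fun t => pow_nonneg (sub_nonneg.2 (Real.cos_le_one t)) D
  · exact hcont.integrableOn_Icc

/-- **The exponent of the one-variable engine must decay like `1/(2D)`.**  For every degree `D ≥ 1`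
there are NO constants `C` and `c > 1/(2D)` such that every non-negative trigonometric polynomial `f`
of degree `≤ D` with positive mean satisfies `|{t ∈ [-π,π] : f t ≤ ε ⨍ f}| ≤ C ε^c` for all `ε > 0`:
the witness `f = (1 - cos)^D ≤ (t²/2)^D` has `{f ≤ ε⨍f} ⊇ [-ρ, ρ]` with `ρ = √2 (ε⨍f)^{1/(2D)}`.  So in
`CircleSmallBall` (line `circle-transport`, stub `stub_circleEngine`) `c ≤ 1/(2D)` is forced — with
`D = 8 N_f` downstream, this is the engine-level form of `not_tiltedFlatness_uniform_in_Nf`. [folklore] -/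
theorem not_circleSmallBall_exponent_gt (D : ℕ) (hD : 1 ≤ D) :
    ¬ (∃ C c : ℝ, 1 / (2 * (D : ℝ)) < c ∧ ∀ f : ℝ → ℝ,
        (∃ a : ℤ → ℂ, ∀ t : ℝ, ((f t : ℝ) : ℂ) =
          ∑ k ∈ Finset.Icc (-(D : ℤ)) D, a k * Complex.exp ((k : ℂ) * (t : ℂ) * Complex.I)) →
        (∀ t, 0 ≤ f t) → 0 < ∫ t in Set.Icc (-π) π, f t → ∀ ε : ℝ, 0 < ε →
          volume {t ∈ Set.Icc (-π) π | f t ≤ ε * ((∫ s in Set.Icc (-π) π, f s) / (2 * π))} ≤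
            ENNReal.ofReal (C * ε ^ c)) := by
  rintro ⟨C, c, hc, H⟩
  have hD0 : (0 : ℝ) < D := by exact_mod_cast hD
  have hDne : (D : ℝ) ≠ 0 := hD0.ne'
  set f : ℝ → ℝ := fun t => (1 - Real.cos t) ^ D with hf
  have hf_trig : ∃ a : ℤ → ℂ, ∀ t : ℝ, ((f t : ℝ) : ℂ) =
      ∑ k ∈ Finset.Icc (-(D : ℤ)) D, a k * Complex.exp ((k : ℂ) * (t : ℂ) * Complex.I) :=
    one_sub_cos_pow_trig D
  have hf_nn : ∀ t, 0 ≤ f t := fun t => pow_nonneg (sub_nonneg.2 (Real.cos_le_one t)) D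
  set m : ℝ := ∫ t in Set.Icc (-π) π, f t with hm
  have hm0 : 0 < m := integral_one_sub_cos_pow_pos D
  -- the mean and its `1/(2D)`-th root
  set μ₀ : ℝ := (m / (2 * π)) ^ (1 / (2 * (D : ℝ))) with hμ₀
  have hmean : 0 < m / (2 * π) := by positivity
  have hμ₀0 : 0 < μ₀ := Real.rpow_pos_of_pos hmean _
  -- the exponent gap
  set s : ℝ := c - 1 / (2 * (D : ℝ)) with hs
  have hs0 : 0 < s := by rw [hs]; linarith
  -- the case `C ≤ 0` is absorbed below; choose `ε`
  set q : ℝ := Real.sqrt 2 * μ₀ / (max C 1) with hq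
  have hC1 : 0 < max C 1 := lt_max_of_lt_right one_pos
  have hq0 : 0 < q := by positivity
  set ε : ℝ := min (min 1 (2 * π / m)) (q ^ (1 / s)) with hε
  have hε0 : 0 < ε := lt_min (lt_min one_pos (by positivity)) (Real.rpow_pos_of_pos hq0 _)
  have hε1 : ε ≤ 1 := (min_le_left _ _).trans (min_le_left _ _)
  have hε2 : ε ≤ 2 * π / m := (min_le_left _ _).trans (min_le_right _ _)
  have hεs : ε ^ s ≤ q := by
    calc ε ^ s ≤ (q ^ (1 / s)) ^ s :=
          Real.rpow_le_rpow hε0.le (min_le_right _ _) hs0.le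
      _ = q := by rw [← Real.rpow_mul hq0.le, one_div, inv_mul_cancel₀ hs0.ne', Real.rpow_one]
  -- the threshold `τ = ε ⨍ f ≤ 1`
  set τ : ℝ := ε * (m / (2 * π)) with hτ
  have hτ0 : 0 < τ := by positivity
  have hτ1 : τ ≤ 1 := by
    rw [hτ]
    calc ε * (m / (2 * π)) ≤ (2 * π / m) * (m / (2 * π)) := by gcongr
      _ = 1 := by field_simp
  -- the radius `ρ = √2 τ^{1/(2D)}` and `ρ² = 2 τ^{1/D}`
  set ρ : ℝ := Real.sqrt 2 * τ ^ (1 / (2 * (D : ℝ))) with hρ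
  have h2 : 0 < Real.sqrt 2 := Real.sqrt_pos.2 (by norm_num)
  have hρ0 : 0 < ρ := by positivity
  have hρsq : ρ ^ 2 = 2 * τ ^ (1 / (D : ℝ)) := by
    rw [hρ, mul_pow, Real.sq_sqrt (by norm_num : (0:ℝ) ≤ 2)]
    congr 1
    rw [← Real.rpow_natCast, ← Real.rpow_mul hτ0.le]
    congr 1
    push_cast
    field_simp
  have hτD : (τ ^ (1 / (D : ℝ))) ^ D = τ := by
    rw [← Real.rpow_natCast, ← Real.rpow_mul hτ0.le, one_div, inv_mul_cancel₀ hDne, Real.rpow_one]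
  have hτD1 : τ ^ (1 / (D : ℝ)) ≤ 1 := Real.rpow_le_one hτ0.le hτ1 (by positivity)
  have hρπ : ρ ≤ π := by
    have hρ2 : ρ ^ 2 ≤ 2 := by rw [hρsq]; linarith
    have h32 : Real.sqrt 2 < 3 / 2 := by
      rw [show (3 / 2 : ℝ) = Real.sqrt ((3/2)^2) by rw [Real.sqrt_sq (by norm_num)]]
      exact Real.sqrt_lt_sqrt (by norm_num) (by norm_num)
    have : ρ ≤ Real.sqrt 2 := by
      rw [← Real.sqrt_sq hρ0.le]
      exact Real.sqrt_le_sqrt hρ2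
    linarith [Real.pi_gt_three]
  -- the interval `[-ρ, ρ]` lies in the sublevel set
  have hsub : Set.Icc (-ρ) ρ ⊆ {t ∈ Set.Icc (-π) π | f t ≤ ε * (m / (2 * π))} := by
    intro t ht
    refine ⟨⟨by linarith [ht.1], by linarith [ht.2]⟩, ?_⟩
    have hcos := Real.one_sub_sq_div_two_le_cos (x := t)
    have ht2 : t ^ 2 ≤ ρ ^ 2 := by
      have : |t| ≤ ρ := abs_le.2 ⟨ht.1, ht.2⟩
      nlinarith [abs_nonneg t, sq_abs t]
    have hhalf : t ^ 2 / 2 ≤ τ ^ (1 / (D : ℝ)) := by rw [hρsq] at ht2; linarith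
    show (1 - Real.cos t) ^ D ≤ ε * (m / (2 * π))
    calc (1 - Real.cos t) ^ D ≤ (t ^ 2 / 2) ^ D :=
          pow_le_pow_left₀ (sub_nonneg.2 (Real.cos_le_one t)) (by linarith) D
      _ ≤ (τ ^ (1 / (D : ℝ))) ^ D := pow_le_pow_left₀ (by positivity) hhalf D
      _ = τ := hτD
  have key := H f hf_trig hf_nn hm0 ε hε0
  have hmono := (measure_mono (μ := volume) hsub).trans key
  rw [Real.volume_Icc, ENNReal.ofReal_le_ofReal_iff'] at hmono
  have h2ρ : 2 * ρ ≤ C * ε ^ c := by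
    rcases hmono with h | h
    · linarith
    · linarith
  -- `2ρ = 2√2 μ₀ ε^{1/(2D)}` while `C ε^c ≤ (max C 1) ε^s ε^{1/(2D)} ≤ √2 μ₀ ε^{1/(2D)}`
  have hε2D : 0 < ε ^ (1 / (2 * (D : ℝ))) := Real.rpow_pos_of_pos hε0 _
  have hρε : ρ = Real.sqrt 2 * μ₀ * ε ^ (1 / (2 * (D : ℝ))) := by
    rw [hρ, hτ, hμ₀, Real.mul_rpow hε0.le hmean.le]
    ring
  have hsplit : ε ^ c = ε ^ s * ε ^ (1 / (2 * (D : ℝ))) := by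
    rw [← Real.rpow_add hε0]; congr 1; rw [hs]; ring
  have hup : C * ε ^ c ≤ Real.sqrt 2 * μ₀ * ε ^ (1 / (2 * (D : ℝ))) := by
    rw [hsplit, ← mul_assoc]
    have h1 : C * ε ^ s ≤ max C 1 * ε ^ s :=
      mul_le_mul_of_nonneg_right (le_max_left _ _) (Real.rpow_nonneg hε0.le _)
    have h2' : max C 1 * ε ^ s ≤ Real.sqrt 2 * μ₀ := by
      calc max C 1 * ε ^ s ≤ max C 1 * q := by gcongr
        _ = Real.sqrt 2 * μ₀ := by rw [hq]; field_simp
    exact mul_le_mul_of_nonneg_right (h1.trans h2') hε2D.le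
  have hfin : 2 * ρ ≤ Real.sqrt 2 * μ₀ * ε ^ (1 / (2 * (D : ℝ))) := h2ρ.trans hup
  rw [hρε] at hfin
  have hpos : 0 < Real.sqrt 2 * μ₀ * ε ^ (1 / (2 * (D : ℝ))) := by positivity
  linarith


/-! ### §10.2  Load-bearing hypotheses of the two abstract `SU(3)^E` stubs (CERTIFIED; landing as
`Theorems/TiltedFlatness/Negative/CircleTransportLoadBearing.lean`, same names in namespace
`Summit.QuantumFields.QCD.Theorems.TiltedFlatnessNegative`): two-sidedness of the circles in the lead's
`FibreSmallBalls` (`not_fibreSmallBalls_oneSided`), `n`-dependence of its constants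
(`not_fibreSmallBalls_uniform_in_n`), Haar-nullity of the block subgroup `{‖g₀₀‖ = 1}`
(`haar_norm00_eq_one_null`), and two-sidedness of the Lipschitz circles in `FibreDensity`
(`not_fibreDensity_oneSided`), `n`-dependence of its exponent (`not_fibreDensity_uniform_in_n`) -/

/-- `SU(3)` -/
local notation "SU3" => Matrix.specialUnitaryGroup (Fin 3) ℂ

section OneSidedSmallBalls
/-- The signed permutation matrix `swap = [[0,1,0],[-1,0,0],[0,0,1]]` (vanishing `(0,0)` entry) is special unitary. [folklore] -/
theorem swap_mem_specialUnitaryGroup :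
    !![(0:ℂ), 1, 0; -1, 0, 0; 0, 0, 1] ∈ Matrix.specialUnitaryGroup (Fin 3) ℂ := by
  rw [Matrix.mem_specialUnitaryGroup_iff, Matrix.mem_unitaryGroup_iff]
  constructor
  · ext i j
    fin_cases i <;> fin_cases j <;>
      simp [Matrix.mul_apply, Fin.sum_univ_three, Matrix.star_eq_conjTranspose]
  · simp [Matrix.det_fin_three]

/-- Entries of a special unitary matrix have norm `≤ 1`. [folklore] -/
theorem entry_norm_le_one (g : SU3) (i j : Fin 3) : ‖(g : Matrix (Fin 3) (Fin 3) ℂ) i j‖ ≤ 1 := by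
  have := g.2
  rw [Matrix.mem_specialUnitaryGroup_iff] at this
  exact entry_norm_bound_of_unitary this.1 i j

/-- Right multiplication by the diagonal circle `diag(e^{it}, e^{-it}, 1)` does not change `‖g₀₀‖`. [folklore] -/
theorem norm_mul_diag_00 (T : ℝ → SU3)
    (hT : ∀ θ : ℝ, ((T θ : SU3) : Matrix (Fin 3) (Fin 3) ℂ) =
      Matrix.diagonal ![Complex.exp (θ * Complex.I), Complex.exp (-(θ * Complex.I)), 1])
    (g : SU3) (t : ℝ) :
    ‖((g * T t : SU3) : Matrix (Fin 3) (Fin 3) ℂ) 0 0‖ = ‖(g : Matrix (Fin 3) (Fin 3) ℂ) 0 0‖ := by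
  have hmul : ((g * T t : SU3) : Matrix (Fin 3) (Fin 3) ℂ) = (g : Matrix (Fin 3) (Fin 3) ℂ) * (T t : SU3) :=
    rfl
  rw [hmul, hT t, Matrix.mul_apply, Fin.sum_univ_three]
  simp [Matrix.diagonal, Complex.norm_exp_ofReal_mul_I]

/-- Left multiplication by the diagonal circle `diag(e^{it}, e^{-it}, 1)` does not change `‖g₀₀‖`. [folklore] -/
theorem norm_diag_mul_00 (T : ℝ → SU3)
    (hT : ∀ θ : ℝ, ((T θ : SU3) : Matrix (Fin 3) (Fin 3) ℂ) =
      Matrix.diagonal ![Complex.exp (θ * Complex.I), Complex.exp (-(θ * Complex.I)), 1])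
    (g : SU3) (t : ℝ) :
    ‖((T t * g : SU3) : Matrix (Fin 3) (Fin 3) ℂ) 0 0‖ = ‖(g : Matrix (Fin 3) (Fin 3) ℂ) 0 0‖ := by
  have hmul : ((T t * g : SU3) : Matrix (Fin 3) (Fin 3) ℂ) = ((T t : SU3) : Matrix (Fin 3) (Fin 3) ℂ) * g :=
    rfl
  rw [hmul, hT t, Matrix.mul_apply, Fin.sum_univ_three]
  simp [Matrix.diagonal, Complex.norm_exp_ofReal_mul_I]

/-- **Two-sidedness of the circles is load-bearing in `FibreSmallBalls`.**  If the band-limit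
hypothesis of the abstract Haar small-ball statement is asked only along the ONE-SIDED circles
`t ↦ W[r i ↦ W(r i)·T(t)]` and `t ↦ W[r i ↦ T(t)·W(r i)]` (instead of `A·T(t)·B` for all `A, B`), the
statement is FALSE already for `D = 0`, `n = 1`: `F(W) = max(0, 1 − 2‖W(e)₀₀‖²)` is continuous, `≥ 0`,
CONSTANT along all one-sided diagonal circles (they only rephase the entry), positive at the signed
permutation, and vanishes on the Haar-open set `{‖g₀₀‖² > 1/2} ∋ 1`, so `Haar{F ≤ ε F(W₀)}` does not tend
to `0`.  (Any proof of `stub_haarSmallBalls` must use conjugated circles `V T V⁻¹`, i.e. `B ≠ 1`.) [folklore] -/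
theorem not_fibreSmallBalls_oneSided (T : ℝ → SU3)
    (hT : ∀ θ : ℝ, ((T θ : SU3) : Matrix (Fin 3) (Fin 3) ℂ) =
      Matrix.diagonal ![Complex.exp (θ * Complex.I), Complex.exp (-(θ * Complex.I)), 1]) :
    ¬ (∀ (D n : ℕ), ∃ C c : ℝ, 0 < C ∧ 0 < c ∧
      ∀ (E : Type) [Fintype E] [DecidableEq E] (ι : Type) [Fintype ι] (r : ι → E), Fintype.card ι ≤ n →
      ∀ F : (E → SU3) → ℝ, Continuous F → (∀ W, 0 ≤ F W) →
        (∀ W W' : E → SU3, (∀ i, W (r i) = W' (r i)) → F W = F W') →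
        (∀ (W : E → SU3) (i : ι),
          (∃ a : ℤ → ℂ, ∀ t : ℝ,
            ((F (Function.update W (r i) (W (r i) * T t)) ^ 2 : ℝ) : ℂ) =
              ∑ k ∈ Finset.Icc (-(D : ℤ)) D, a k * Complex.exp ((k : ℂ) * (t : ℂ) * Complex.I)) ∧
          (∃ a : ℤ → ℂ, ∀ t : ℝ,
            ((F (Function.update W (r i) (T t * W (r i))) ^ 2 : ℝ) : ℂ) =
              ∑ k ∈ Finset.Icc (-(D : ℤ)) D, a k * Complex.exp ((k : ℂ) * (t : ℂ) * Complex.I))) →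
        ∀ W₀ : E → SU3, 0 < F W₀ → ∀ ε : ℝ, 0 < ε →
          ((Measure.pi fun _ : E => haarProbability SU3) {W | F W ≤ ε * F W₀}).toReal ≤ C * ε ^ c) := by
  intro H
  obtain ⟨C, c, hC, hc, H⟩ := H 0 1
  -- the witness on one coordinate
  let φ : SU3 → ℝ := fun g => max 0 (1 - 2 * ‖(g : Matrix (Fin 3) (Fin 3) ℂ) 0 0‖ ^ 2)
  let F : (Fin 1 → SU3) → ℝ := fun W => φ (W 0)
  have hφ_cont : Continuous φ :=
    continuous_const.max (continuous_const.sub (continuous_const.mul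
      ((continuous_norm.comp ((continuous_apply_apply 0 0).comp continuous_subtype_val)).pow 2)))
  have hF_cont : Continuous F := hφ_cont.comp (continuous_apply 0)
  have hF_nn : ∀ W, 0 ≤ F W := fun W => le_max_left _ _
  have hF_dep : ∀ W W' : Fin 1 → SU3, (∀ i : Fin 1, W (id i) = W' (id i)) → F W = F W' := by
    intro W W' h
    show φ (W 0) = φ (W' 0)
    rw [← show W (id 0) = W 0 from rfl, h 0]
    rfl
  have hIcc : Finset.Icc (-((0 : ℕ) : ℤ)) ((0 : ℕ) : ℤ) = {0} := by decide
  have hF_bl : ∀ (W : Fin 1 → SU3) (i : Fin 1),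
      (∃ a : ℤ → ℂ, ∀ t : ℝ,
        ((F (Function.update W (id i) (W (id i) * T t)) ^ 2 : ℝ) : ℂ) =
          ∑ k ∈ Finset.Icc (-((0 : ℕ) : ℤ)) ((0 : ℕ) : ℤ), a k * Complex.exp ((k : ℂ) * (t : ℂ) * Complex.I)) ∧
      (∃ a : ℤ → ℂ, ∀ t : ℝ,
        ((F (Function.update W (id i) (T t * W (id i))) ^ 2 : ℝ) : ℂ) =
          ∑ k ∈ Finset.Icc (-((0 : ℕ) : ℤ)) ((0 : ℕ) : ℤ), a k * Complex.exp ((k : ℂ) * (t : ℂ) * Complex.I)) := by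
    intro W i
    obtain rfl : i = 0 := Subsingleton.elim i 0
    refine ⟨⟨fun _ => ((φ (W 0) ^ 2 : ℝ) : ℂ), fun t => ?_⟩, ⟨fun _ => ((φ (W 0) ^ 2 : ℝ) : ℂ), fun t => ?_⟩⟩
    · rw [hIcc, Finset.sum_singleton]
      simp only [Int.cast_zero, zero_mul, Complex.exp_zero, mul_one]
      show (((φ (Function.update W 0 (W 0 * T t) 0)) ^ 2 : ℝ) : ℂ) = _
      rw [Function.update_self]
      simp only [φ, norm_mul_diag_00 T hT]
    · rw [hIcc, Finset.sum_singleton]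
      simp only [Int.cast_zero, zero_mul, Complex.exp_zero, mul_one]
      show (((φ (Function.update W 0 (T t * W 0) 0)) ^ 2 : ℝ) : ℂ) = _
      rw [Function.update_self]
      simp only [φ, norm_diag_mul_00 T hT]
  -- the reference point: the signed permutation, `F = 1`
  let P : SU3 := ⟨!![(0:ℂ), 1, 0; -1, 0, 0; 0, 0, 1], swap_mem_specialUnitaryGroup⟩
  let W₀ : Fin 1 → SU3 := fun _ => P
  have hFW₀ : F W₀ = 1 := by
    show max 0 (1 - 2 * ‖(!![(0:ℂ), 1, 0; -1, 0, 0; 0, 0, 1] : Matrix (Fin 3) (Fin 3) ℂ) 0 0‖ ^ 2) = 1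
    simp
  have hW₀ : 0 < F W₀ := by rw [hFW₀]; exact one_pos
  -- the Haar-open set where `F = 0`
  let V : Set SU3 := {g | 1 / 2 < ‖(g : Matrix (Fin 3) (Fin 3) ℂ) 0 0‖ ^ 2}
  have hV_open : IsOpen V :=
    isOpen_lt continuous_const
      ((continuous_norm.comp ((continuous_apply_apply 0 0).comp continuous_subtype_val)).pow 2)
  have h1V : (1 : SU3) ∈ V := by
    show 1 / 2 < ‖((1 : SU3) : Matrix (Fin 3) (Fin 3) ℂ) 0 0‖ ^ 2
    norm_num
  let μ : Measure (Fin 1 → SU3) := Measure.pi fun _ => haarProbability SU3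
  haveI : (haarProbability SU3).IsOpenPosMeasure := by unfold haarProbability; infer_instance
  haveI : IsProbabilityMeasure μ := by
    show IsProbabilityMeasure (Measure.pi fun _ : Fin 1 => haarProbability SU3); infer_instance
  have hVpos : 0 < haarProbability SU3 V := hV_open.measure_pos _ ⟨1, h1V⟩
  have hVfin : haarProbability SU3 V ≠ ⊤ := measure_ne_top _ _
  set v : ℝ := (haarProbability SU3 V).toReal with hv
  have hv0 : 0 < v := ENNReal.toReal_pos hVpos.ne' hVfin
  -- for every `ε > 0` the sublevel set has mass `≥ v`
  have hfloor : ∀ ε : ℝ, 0 < ε → v ≤ (μ {W | F W ≤ ε * F W₀}).toReal := by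
    intro ε hε
    have hsub : Set.pi Set.univ (fun _ : Fin 1 => V) ⊆ {W | F W ≤ ε * F W₀} := by
      intro W hW
      have h0 : W 0 ∈ V := hW 0 (Set.mem_univ _)
      have h0' : 1 / 2 < ‖((W 0 : SU3) : Matrix (Fin 3) (Fin 3) ℂ) 0 0‖ ^ 2 := h0
      have hF0 : F W = 0 := by
        show max 0 (1 - 2 * ‖((W 0 : SU3) : Matrix (Fin 3) (Fin 3) ℂ) 0 0‖ ^ 2) = 0
        exact max_eq_left (by linarith)
      show F W ≤ ε * F W₀
      rw [hF0, hFW₀]; linarith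
    have hpi : μ (Set.pi Set.univ (fun _ : Fin 1 => V)) = haarProbability SU3 V := by
      show (Measure.pi fun _ : Fin 1 => haarProbability SU3) (Set.pi Set.univ (fun _ : Fin 1 => V)) = _
      rw [Measure.pi_pi]
      simp
    rw [hv, ← hpi]
    exact ENNReal.toReal_mono (measure_ne_top _ _) (measure_mono hsub)
  -- choose `ε` with `C ε^c ≤ v/2`
  set q : ℝ := v / (2 * C) with hq
  have hq0 : 0 < q := by positivity
  set ε : ℝ := q ^ (1 / c) with hε
  have hε0 : 0 < ε := Real.rpow_pos_of_pos hq0 _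
  have hεc : ε ^ c = q := by
    rw [hε, ← Real.rpow_mul hq0.le, one_div, inv_mul_cancel₀ hc.ne', Real.rpow_one]
  have key := H (Fin 1) (Fin 1) id (by simp) F hF_cont hF_nn hF_dep hF_bl W₀ hW₀ ε hε0
  have := (hfloor ε hε0).trans key
  rw [hεc, hq] at this
  have : C * (v / (2 * C)) = v / 2 := by field_simp
  linarith

end OneSidedSmallBalls

section NDependence

/-- `-1 ≤ Re g₀₀ ≤ 1` for `g ∈ SU(3)`. [folklore] -/
theorem re00_bounds (g : SU3) :
    -1 ≤ ((g : Matrix (Fin 3) (Fin 3) ℂ) 0 0).re ∧ ((g : Matrix (Fin 3) (Fin 3) ℂ) 0 0).re ≤ 1 := by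
  have h1 := entry_norm_le_one g 0 0
  have h2 := Complex.abs_re_le_norm ((g : Matrix (Fin 3) (Fin 3) ℂ) 0 0)
  constructor
  · linarith [neg_abs_le ((g : Matrix (Fin 3) (Fin 3) ℂ) 0 0).re]
  · linarith [le_abs_self ((g : Matrix (Fin 3) (Fin 3) ℂ) 0 0).re]

/-- The `(0,0)` entry along a two-sided diagonal circle `A · diag(e^{it}, e^{-it}, 1) · B` is the degree-1
trigonometric polynomial `A₀₀B₀₀ e^{it} + A₀₁B₁₀ e^{-it} + A₀₂B₂₀`. [folklore] -/
theorem entry00_twoSided (T : ℝ → SU3)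
    (hT : ∀ θ : ℝ, ((T θ : SU3) : Matrix (Fin 3) (Fin 3) ℂ) =
      Matrix.diagonal ![Complex.exp (θ * Complex.I), Complex.exp (-(θ * Complex.I)), 1])
    (A B : SU3) (t : ℝ) :
    ((A * T t * B : SU3) : Matrix (Fin 3) (Fin 3) ℂ) 0 0 =
      (A : Matrix (Fin 3) (Fin 3) ℂ) 0 0 * (B : Matrix (Fin 3) (Fin 3) ℂ) 0 0 * Complex.exp (t * Complex.I) +
      (A : Matrix (Fin 3) (Fin 3) ℂ) 0 1 * (B : Matrix (Fin 3) (Fin 3) ℂ) 1 0 * Complex.exp (-(t * Complex.I)) +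
      (A : Matrix (Fin 3) (Fin 3) ℂ) 0 2 * (B : Matrix (Fin 3) (Fin 3) ℂ) 2 0 := by
  have hmul : ((A * T t * B : SU3) : Matrix (Fin 3) (Fin 3) ℂ) =
      (A : Matrix (Fin 3) (Fin 3) ℂ) * (T t : SU3) * (B : Matrix (Fin 3) (Fin 3) ℂ) := rfl
  rw [hmul, hT t, Matrix.mul_apply, Fin.sum_univ_three, Matrix.mul_apply, Matrix.mul_apply, Matrix.mul_apply,
    Fin.sum_univ_three, Fin.sum_univ_three, Fin.sum_univ_three]
  simp [Matrix.diagonal]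
  ring

/-- The diagonal matrix `diag(-1,-1,1)` is special unitary. [folklore] -/
theorem negneg_mem_specialUnitaryGroup :
    Matrix.diagonal ![(-1 : ℂ), -1, 1] ∈ Matrix.specialUnitaryGroup (Fin 3) ℂ := by
  rw [Matrix.mem_specialUnitaryGroup_iff, Matrix.mem_unitaryGroup_iff]
  constructor
  · rw [Matrix.star_eq_conjTranspose, Matrix.diagonal_conjTranspose, Matrix.diagonal_mul_diagonal,
      ← Matrix.diagonal_one]
    congr 1
    funext i
    fin_cases i <;> simp
  · rw [Matrix.det_diagonal, Fin.prod_univ_three]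
    simp

/-- **The constants of `FibreSmallBalls` must depend on the number `n` of listed coordinates.**  With
`Fintype.card ι ≤ n` dropped (constants depending on the degree only) the abstract Haar small-ball
statement is FALSE: `F(W) = Π_e φ(W e)`, `φ(g) = √((1 + Re g₀₀)/2)` has `F²` of degree `1` along every
two-sided circle, `F(1) = 1`, and `Haar^N{F ≤ ε} ≥ 1 − (1 − Haar{φ < ε})^N → 1` (`N → ∞`) for every
fixed `ε > 0`.  (Abstract twin of `not_tiltedFlatness_uniform_in_Nf`; irrelevant to the crux, where
`n ≤ 16`, but any proof of `stub_haarSmallBalls` must let `C, c` degrade with `n`.) [folklore] -/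
theorem not_fibreSmallBalls_uniform_in_n (T : ℝ → SU3)
    (hT : ∀ θ : ℝ, ((T θ : SU3) : Matrix (Fin 3) (Fin 3) ℂ) =
      Matrix.diagonal ![Complex.exp (θ * Complex.I), Complex.exp (-(θ * Complex.I)), 1]) :
    ¬ (∀ D : ℕ, ∃ C c : ℝ, 0 < C ∧ 0 < c ∧
      ∀ (E : Type) [Fintype E] [DecidableEq E] (ι : Type) [Fintype ι] (r : ι → E),
      ∀ F : (E → SU3) → ℝ, Continuous F → (∀ W, 0 ≤ F W) →
        (∀ W W' : E → SU3, (∀ i, W (r i) = W' (r i)) → F W = F W') →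
        (∀ (W : E → SU3) (i : ι) (A B : SU3), ∃ a : ℤ → ℂ, ∀ t : ℝ,
          ((F (Function.update W (r i) (A * T t * B)) ^ 2 : ℝ) : ℂ) =
            ∑ k ∈ Finset.Icc (-(D : ℤ)) D, a k * Complex.exp ((k : ℂ) * (t : ℂ) * Complex.I)) →
        ∀ W₀ : E → SU3, 0 < F W₀ → ∀ ε : ℝ, 0 < ε →
          ((Measure.pi fun _ : E => haarProbability SU3) {W | F W ≤ ε * F W₀}).toReal ≤ C * ε ^ c) := by
  intro H
  obtain ⟨C, c, hC, hc, H⟩ := H 1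
  -- the one-link amplitude
  let ψ : SU3 → ℝ := fun g => (1 + ((g : Matrix (Fin 3) (Fin 3) ℂ) 0 0).re) / 2
  let φ : SU3 → ℝ := fun g => Real.sqrt (ψ g)
  have hψ_nn : ∀ g, 0 ≤ ψ g := fun g => by
    have := (re00_bounds g).1; show 0 ≤ (1 + _) / 2; linarith
  have hψ_le : ∀ g, ψ g ≤ 1 := fun g => by
    have := (re00_bounds g).2; show (1 + _) / 2 ≤ 1; linarith
  have hφ_nn : ∀ g, 0 ≤ φ g := fun g => Real.sqrt_nonneg _
  have hφ_le : ∀ g, φ g ≤ 1 := fun g => Real.sqrt_le_one.mpr (hψ_le g) |>.trans_eq rfl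
  have hφ_sq : ∀ g, φ g ^ 2 = ψ g := fun g => Real.sq_sqrt (hψ_nn g)
  have hψ_cont : Continuous ψ :=
    (continuous_const.add (Complex.continuous_re.comp
      ((continuous_apply_apply 0 0).comp continuous_subtype_val))).div_const _
  have hφ_cont : Continuous φ := Real.continuous_sqrt.comp hψ_cont
  -- fix `ε` with `C ε^c = 1/2`
  set q : ℝ := 1 / (2 * C) with hq
  have hq0 : 0 < q := by positivity
  set ε : ℝ := q ^ (1 / c) with hε
  have hε0 : 0 < ε := Real.rpow_pos_of_pos hq0 _
  have hεc : C * ε ^ c = 1 / 2 := by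
    rw [hε, ← Real.rpow_mul hq0.le, one_div, inv_mul_cancel₀ hc.ne', Real.rpow_one, hq]
    field_simp
  -- the open set where `φ < ε`, of positive Haar mass `h`
  let V : Set SU3 := {g | ψ g < ε ^ 2}
  have hV_open : IsOpen V := isOpen_lt hψ_cont continuous_const
  have hV_meas : MeasurableSet V := hV_open.measurableSet
  let g₀ : SU3 := ⟨Matrix.diagonal ![(-1 : ℂ), -1, 1], negneg_mem_specialUnitaryGroup⟩
  have hg₀V : g₀ ∈ V := by
    show (1 + ((Matrix.diagonal ![(-1 : ℂ), -1, 1] : Matrix (Fin 3) (Fin 3) ℂ) 0 0).re) / 2 < ε ^ 2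
    simp only [Matrix.diagonal_apply_eq, Matrix.cons_val_zero]
    norm_num
    positivity
  haveI : (haarProbability SU3).IsOpenPosMeasure := by unfold haarProbability; infer_instance
  haveI hprob : IsProbabilityMeasure (haarProbability SU3) := by infer_instance
  have hVpos : 0 < haarProbability SU3 V := hV_open.measure_pos _ ⟨g₀, hg₀V⟩
  have hVle : haarProbability SU3 V ≤ 1 := prob_le_one
  set h : ℝ := (haarProbability SU3 V).toReal with hh
  have hh0 : 0 < h := ENNReal.toReal_pos hVpos.ne' (measure_ne_top _ _)
  have hh1 : h ≤ 1 := by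
    rw [hh, ← ENNReal.toReal_one]; exact ENNReal.toReal_mono ENNReal.one_ne_top hVle
  -- choose `N` with `(1 - h)^N < 1/2`
  obtain ⟨N, hN⟩ : ∃ N : ℕ, (1 - h) ^ N < 1 / 2 :=
    exists_pow_lt_of_lt_one (by norm_num) (by linarith)
  -- the product amplitude on `N` links
  let F : (Fin N → SU3) → ℝ := fun W => ∏ e, φ (W e)
  have hF_cont : Continuous F := continuous_finsetProd _ fun e _ => hφ_cont.comp (continuous_apply e)
  have hF_nn : ∀ W, 0 ≤ F W := fun W => Finset.prod_nonneg fun e _ => hφ_nn _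
  have hF_dep : ∀ W W' : Fin N → SU3, (∀ i : Fin N, W (id i) = W' (id i)) → F W = F W' := by
    intro W W' hWW'
    have : W = W' := funext fun i => hWW' i
    rw [this]
  have hIcc : Finset.Icc (-((1 : ℕ) : ℤ)) ((1 : ℕ) : ℤ) = {-1, 0, 1} := by decide
  have hF_bl : ∀ (W : Fin N → SU3) (i : Fin N) (A B : SU3), ∃ a : ℤ → ℂ, ∀ t : ℝ,
      ((F (Function.update W (id i) (A * T t * B)) ^ 2 : ℝ) : ℂ) =
        ∑ k ∈ Finset.Icc (-((1 : ℕ) : ℤ)) ((1 : ℕ) : ℤ), a k * Complex.exp ((k : ℂ) * (t : ℂ) * Complex.I) := by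
    intro W i A B
    -- the frozen factor
    set P : ℝ := ∏ e ∈ ({i}ᶜ : Finset (Fin N)), ψ (W e) with hP
    set c₁ : ℂ := (A : Matrix (Fin 3) (Fin 3) ℂ) 0 0 * (B : Matrix (Fin 3) (Fin 3) ℂ) 0 0 with hc₁
    set cm : ℂ := (A : Matrix (Fin 3) (Fin 3) ℂ) 0 1 * (B : Matrix (Fin 3) (Fin 3) ℂ) 1 0 with hcm
    set c₀ : ℂ := (A : Matrix (Fin 3) (Fin 3) ℂ) 0 2 * (B : Matrix (Fin 3) (Fin 3) ℂ) 2 0 with hc₀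
    refine ⟨fun k => (P : ℂ) * (if k = 1 then (c₁ + (starRingEnd ℂ) cm) / 4 else
      if k = -1 then (cm + (starRingEnd ℂ) c₁) / 4 else (1 / 2 + (c₀ + (starRingEnd ℂ) c₀) / 4)), fun t => ?_⟩
    -- the square of the product splits off the moving factor
    have hsq : F (Function.update W (id i) (A * T t * B)) ^ 2 = ψ (A * T t * B) * P := by
      show (∏ e, φ (Function.update W i (A * T t * B) e)) ^ 2 = _
      rw [← Finset.prod_pow, Fintype.prod_eq_mul_prod_compl i]
      congr 1
      · rw [Function.update_self, hφ_sq]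
      · refine Finset.prod_congr rfl fun e he => ?_
        rw [Finset.mem_compl, Finset.mem_singleton] at he
        rw [Function.update_of_ne he, hφ_sq]
    rw [hsq, hIcc, Finset.sum_insert (by decide), Finset.sum_insert (by decide), Finset.sum_singleton]
    have hu := entry00_twoSided T hT A B t
    have hψu : ((ψ (A * T t * B) : ℝ) : ℂ) =
        (1 + ((((A * T t * B : SU3) : Matrix (Fin 3) (Fin 3) ℂ) 0 0) +
          (starRingEnd ℂ) (((A * T t * B : SU3) : Matrix (Fin 3) (Fin 3) ℂ) 0 0)) / 2) / 2 := by
      show ((((1 + (((A * T t * B : SU3) : Matrix (Fin 3) (Fin 3) ℂ) 0 0).re) / 2 : ℝ)) : ℂ) = _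
      push_cast
      rw [Complex.re_eq_add_conj]
    have hconj : (starRingEnd ℂ) (((A * T t * B : SU3) : Matrix (Fin 3) (Fin 3) ℂ) 0 0) =
        (starRingEnd ℂ) c₁ * Complex.exp (-(t * Complex.I)) +
        (starRingEnd ℂ) cm * Complex.exp (t * Complex.I) + (starRingEnd ℂ) c₀ := by
      rw [hu]
      simp only [hc₁, hcm, hc₀, map_add, map_mul, map_neg, ← Complex.exp_conj, Complex.conj_ofReal,
        Complex.conj_I, mul_neg, neg_neg]
    push_cast
    rw [hψu, hconj, hu]
    simp only [zero_mul, Complex.exp_zero, neg_mul, one_mul]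
    ring
  -- the reference point `W₀ ≡ 1`, `F W₀ = 1`
  have hφ1 : φ 1 = 1 := by
    show Real.sqrt ((1 + (((1 : SU3) : Matrix (Fin 3) (Fin 3) ℂ) 0 0).re) / 2) = 1
    simp
  let W₀ : Fin N → SU3 := fun _ => 1
  have hFW₀ : F W₀ = 1 := by
    show ∏ e : Fin N, φ ((fun _ => (1 : SU3)) e) = 1
    simp [hφ1]
  -- the sublevel set contains the complement of the box `Π_e Vᶜ`
  let μ : Measure (Fin N → SU3) := Measure.pi fun _ => haarProbability SU3
  haveI : IsProbabilityMeasure μ := by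
    show IsProbabilityMeasure (Measure.pi fun _ : Fin N => haarProbability SU3); infer_instance
  let Bad : Set (Fin N → SU3) := Set.pi Set.univ fun _ => Vᶜ
  have hBad_meas : MeasurableSet Bad := MeasurableSet.univ_pi fun _ => hV_meas.compl
  have hsub : Badᶜ ⊆ {W | F W ≤ ε * F W₀} := by
    intro W hW
    simp only [Bad, Set.mem_compl_iff, Set.mem_univ_pi, not_forall, not_not] at hW
    obtain ⟨e, he⟩ := hW
    have hφe : φ (W e) ≤ ε := by
      have : ψ (W e) < ε ^ 2 := he
      calc φ (W e) = Real.sqrt (ψ (W e)) := rfl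
        _ ≤ Real.sqrt (ε ^ 2) := Real.sqrt_le_sqrt this.le
        _ = ε := Real.sqrt_sq hε0.le
    show F W ≤ ε * F W₀
    rw [hFW₀, mul_one]
    show ∏ e', φ (W e') ≤ ε
    rw [Fintype.prod_eq_mul_prod_compl e]
    calc φ (W e) * ∏ e' ∈ ({e}ᶜ : Finset (Fin N)), φ (W e') ≤ ε * 1 := by
          apply mul_le_mul hφe (Finset.prod_le_one (fun _ _ => hφ_nn _) fun _ _ => hφ_le _)
            (Finset.prod_nonneg fun _ _ => hφ_nn _) hε0.le
      _ = ε := mul_one ε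
  -- the mass of `Bad` is `(1 - h)^N`
  have hBad : μ Bad = (1 - haarProbability SU3 V) ^ N := by
    show (Measure.pi fun _ : Fin N => haarProbability SU3) (Set.pi Set.univ fun _ => Vᶜ) = _
    rw [Measure.pi_pi, Finset.prod_const, Finset.card_univ, Fintype.card_fin,
      prob_compl_eq_one_sub hV_meas]
  have hBadc : (μ Badᶜ).toReal = 1 - (1 - h) ^ N := by
    rw [prob_compl_eq_one_sub hBad_meas, hBad,
      ENNReal.toReal_sub_of_le (pow_le_one₀ bot_le tsub_le_self) ENNReal.one_ne_top,
      ENNReal.toReal_one, ENNReal.toReal_pow, ENNReal.toReal_sub_of_le hVle ENNReal.one_ne_top,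
      ENNReal.toReal_one]
  have key := H (Fin N) (Fin N) id F hF_cont hF_nn hF_dep hF_bl W₀ (by rw [hFW₀]; exact one_pos) ε hε0
  have hlow : (μ Badᶜ).toReal ≤ (μ {W | F W ≤ ε * F W₀}).toReal :=
    ENNReal.toReal_mono (measure_ne_top _ _) (measure_mono hsub)
  rw [hBadc] at hlow
  have : 1 - (1 - h) ^ N ≤ C * ε ^ c := hlow.trans key
  rw [hεc] at this
  linarith

end NDependence

section HaarNull

/-- Column `0` of a special unitary matrix has unit norm. [folklore] -/
theorem col0_norm_sq (g : SU3) :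
    ‖(g : Matrix (Fin 3) (Fin 3) ℂ) 0 0‖ ^ 2 + ‖(g : Matrix (Fin 3) (Fin 3) ℂ) 1 0‖ ^ 2 +
      ‖(g : Matrix (Fin 3) (Fin 3) ℂ) 2 0‖ ^ 2 = 1 := by
  obtain ⟨hU, -⟩ := Matrix.mem_specialUnitaryGroup_iff.1 g.2
  have hC : (starRingEnd ℂ) ((g : Matrix (Fin 3) (Fin 3) ℂ) 0 0) * (g : Matrix (Fin 3) (Fin 3) ℂ) 0 0 +
      (starRingEnd ℂ) ((g : Matrix (Fin 3) (Fin 3) ℂ) 1 0) * (g : Matrix (Fin 3) (Fin 3) ℂ) 1 0 +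
      (starRingEnd ℂ) ((g : Matrix (Fin 3) (Fin 3) ℂ) 2 0) * (g : Matrix (Fin 3) (Fin 3) ℂ) 2 0 = 1 := by
    have := congr_fun (congr_fun (Matrix.mem_unitaryGroup_iff'.1 hU) 0) 0
    simpa [Matrix.mul_apply, Fin.sum_univ_three] using this
  rw [Complex.conj_mul', Complex.conj_mul', Complex.conj_mul'] at hC
  exact_mod_cast hC

/-- If `‖g₀₀‖ = 1` then `g₁₀ = 0` (unit column). [folklore] -/
theorem entry10_eq_zero_of_norm00 (g : SU3) (h : ‖(g : Matrix (Fin 3) (Fin 3) ℂ) 0 0‖ = 1) :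
    (g : Matrix (Fin 3) (Fin 3) ℂ) 1 0 = 0 := by
  have hcol := col0_norm_sq g
  rw [h, one_pow] at hcol
  have h1 : ‖(g : Matrix (Fin 3) (Fin 3) ℂ) 1 0‖ ^ 2 = 0 := by nlinarith [sq_nonneg ‖(g : Matrix (Fin 3) (Fin 3) ℂ) 2 0‖]
  have h1' : ‖(g : Matrix (Fin 3) (Fin 3) ℂ) 1 0‖ = 0 := (pow_eq_zero_iff two_ne_zero).1 h1
  exact norm_eq_zero.1 h1'

/-- The real rotation by `θ` in the `(0,1)` plane is special unitary. [folklore] -/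
theorem rotMatrix_mem (θ : ℝ) :
    !![(Real.cos θ : ℂ), -(Real.sin θ : ℂ), 0; (Real.sin θ : ℂ), (Real.cos θ : ℂ), 0; 0, 0, 1] ∈
      Matrix.specialUnitaryGroup (Fin 3) ℂ := by
  rw [Matrix.mem_specialUnitaryGroup_iff, Matrix.mem_unitaryGroup_iff]
  have key : Complex.cos θ ^ 2 + Complex.sin θ ^ 2 = 1 := Complex.cos_sq_add_sin_sq θ
  constructor
  · ext i j
    fin_cases i <;> fin_cases j <;>
      simp [Matrix.mul_apply, Fin.sum_univ_three, Matrix.star_eq_conjTranspose,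
        ← Complex.cos_conj, ← Complex.sin_conj, Complex.conj_ofReal]
      <;> first | linear_combination key | linear_combination (-1 : ℂ) * key | ring
  · simp [Matrix.det_fin_three]
    linear_combination key

/-- **Haar-nullity of the block subgroup.**  `{g ∈ SU(3) : ‖g₀₀‖ = 1}` (`= S(U(1) × U(2))`) is a Haar
null set: its left translates by the rotations `rot(1/(k+2))`, `k ∈ ℕ`, are pairwise disjoint (they sit in
`{‖g₀₀‖ = cos(1/(k+2))}`) and all have the same Haar mass. [folklore] -/
theorem haar_norm00_eq_one_null :
    haarProbability SU3 {g : SU3 | ‖(g : Matrix (Fin 3) (Fin 3) ℂ) 0 0‖ = 1} = 0 := by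
  set H : Set SU3 := {g : SU3 | ‖(g : Matrix (Fin 3) (Fin 3) ℂ) 0 0‖ = 1} with hH
  haveI : IsProbabilityMeasure (haarProbability SU3) := by infer_instance
  have hHmeas : MeasurableSet H := by
    refine (isClosed_eq ?_ continuous_const).measurableSet
    exact continuous_norm.comp ((continuous_apply_apply 0 0).comp continuous_subtype_val)
  -- the translates
  let θ : ℕ → ℝ := fun k => 1 / ((k : ℝ) + 2)
  have hθdef : ∀ k, θ k = 1 / ((k : ℝ) + 2) := fun k => rfl
  have hθpos : ∀ k, 0 < θ k := fun k => by rw [hθdef]; positivity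
  have hθle : ∀ k, θ k ≤ 1 / 2 := fun k => by
    rw [hθdef]
    exact one_div_le_one_div_of_le (by norm_num) (by have : (0 : ℝ) ≤ k := Nat.cast_nonneg k; linarith)
  have hθinj : ∀ k l, Real.cos (θ k) = Real.cos (θ l) → k = l := by
    intro k l hkl
    have hk1 : θ k ∈ Set.Icc 0 Real.pi := ⟨(hθpos k).le, by linarith [hθle k, Real.pi_gt_three]⟩
    have hl1 : θ l ∈ Set.Icc 0 Real.pi := ⟨(hθpos l).le, by linarith [hθle l, Real.pi_gt_three]⟩
    have := Real.injOn_cos hk1 hl1 hkl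
    rw [hθdef, hθdef] at this
    have hk0 : ((k : ℝ) + 2) ≠ 0 := by positivity
    have hl0 : ((l : ℝ) + 2) ≠ 0 := by positivity
    have h' : ((k : ℝ) + 2) = (l : ℝ) + 2 := by
      have := congrArg (fun x : ℝ => 1 / x) this
      simpa using this
    exact_mod_cast (by linarith : (k : ℝ) = l)
  let rot : ℝ → SU3 := fun t =>
    ⟨!![(Real.cos t : ℂ), -(Real.sin t : ℂ), 0; (Real.sin t : ℂ), (Real.cos t : ℂ), 0; 0, 0, 1], rotMatrix_mem t⟩
  have hrot : ∀ t, ((rot t : SU3) : Matrix (Fin 3) (Fin 3) ℂ) =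
      !![(Real.cos t : ℂ), -(Real.sin t : ℂ), 0; (Real.sin t : ℂ), (Real.cos t : ℂ), 0; 0, 0, 1] := fun t => rfl
  let Hk : ℕ → Set SU3 := fun k => (fun g : SU3 => (rot (θ k))⁻¹ * g) ⁻¹' H
  have hHk_meas : ∀ k, MeasurableSet (Hk k) := fun k =>
    (measurable_const_mul _) (hHmeas)
  have hHk_mass : ∀ k, haarProbability SU3 (Hk k) = haarProbability SU3 H := fun k => by
    show Measure.haarMeasure ⊤ ((fun g : SU3 => (rot (θ k))⁻¹ * g) ⁻¹' H) = Measure.haarMeasure ⊤ H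
    exact measure_preimage_mul _ _ _
  -- on `Hk k`, `‖g₀₀‖ = cos (θ k)`
  have hnorm : ∀ k (g : SU3), g ∈ Hk k → ‖(g : Matrix (Fin 3) (Fin 3) ℂ) 0 0‖ = Real.cos (θ k) := by
    intro k g hg
    have hg' : (rot (θ k))⁻¹ * g ∈ H := hg
    set g' : SU3 := (rot (θ k))⁻¹ * g with hg'def
    have hgg : g = rot (θ k) * g' := by rw [hg'def, ← mul_assoc, mul_inv_cancel, one_mul]
    have h00 : ‖(g' : Matrix (Fin 3) (Fin 3) ℂ) 0 0‖ = 1 := hg'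
    have h10 : (g' : Matrix (Fin 3) (Fin 3) ℂ) 1 0 = 0 := entry10_eq_zero_of_norm00 g' h00
    have hentry : (g : Matrix (Fin 3) (Fin 3) ℂ) 0 0 = (Real.cos (θ k) : ℂ) * (g' : Matrix (Fin 3) (Fin 3) ℂ) 0 0 := by
      rw [hgg]
      show (((rot (θ k) : SU3) : Matrix (Fin 3) (Fin 3) ℂ) * (g' : Matrix (Fin 3) (Fin 3) ℂ)) 0 0 = _
      rw [hrot, Matrix.mul_apply, Fin.sum_univ_three]
      simp [h10]
    rw [hentry, norm_mul, h00, mul_one, Complex.norm_real, Real.norm_eq_abs,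
      abs_of_nonneg (Real.cos_nonneg_of_mem_Icc ⟨by linarith [hθpos k, Real.pi_gt_three],
        by linarith [hθle k, Real.pi_gt_three]⟩)]
  have hdisj : Pairwise (Function.onFun Disjoint Hk) := by
    intro k l hkl
    refine Set.disjoint_left.2 fun g hgk hgl => hkl (hθinj k l ?_)
    rw [← hnorm k g hgk, ← hnorm l g hgl]
  -- sum of equal masses is at most `1`
  have hsum : ∑' k, haarProbability SU3 (Hk k) ≤ 1 := by
    rw [← measure_iUnion hdisj hHk_meas]
    exact prob_le_one
  simp_rw [hHk_mass] at hsum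
  by_contra hne
  rw [ENNReal.tsum_const_eq_top_of_ne_zero hne] at hsum
  exact absurd hsum (by simp)

end HaarNull

section OneSidedUntilt

/-- **One-sided Lipschitz circles do not untilt.**  If the abstract untilt statement `FibreDensity`
(line `circle-transport`, stub `stub_circleUntilt`) asks the `K`-Lipschitz control of `S` only along the
ONE-SIDED circles `W(r i)·T(t)`, `T(t)·W(r i)`, it is FALSE already for `n = 1`, `K = 0`: the actions
`S_λ(W) = λ (1 − ‖W(e)₀₀‖²)`, `λ > 0`, are continuous, CONSTANT along every one-sided diagonal circle, and
their tilted density at `W ≡ 1` (where `S_λ = 0 = min S_λ`) is `1/∫ e^{−βλ(1−‖g₀₀‖²)} dHaar`, which is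
unbounded in `λ` at `β = 1` because `{‖g₀₀‖ = 1}` is Haar-null (`haar_norm00_eq_one_null`) — while the
claimed bound `C (1+β)^p` does not see `λ`.  Companion of `not_fibreSmallBalls_oneSided`. [folklore] -/
theorem not_fibreDensity_oneSided (T : ℝ → SU3)
    (hT : ∀ θ : ℝ, ((T θ : SU3) : Matrix (Fin 3) (Fin 3) ℂ) =
      Matrix.diagonal ![Complex.exp (θ * Complex.I), Complex.exp (-(θ * Complex.I)), 1]) :
    ¬ (∀ (n : ℕ) (K : ℝ), ∃ C p : ℝ, 0 < C ∧
      ∀ (E : Type) [Fintype E] [DecidableEq E] (ι : Type) [Fintype ι] (r : ι → E), Fintype.card ι ≤ n →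
      ∀ S : (E → SU3) → ℝ, Continuous S →
        (∀ W W' : E → SU3, (∀ i, W (r i) = W' (r i)) → S W = S W') →
        (∀ (W : E → SU3) (i : ι) (s s' : ℝ),
          |S (Function.update W (r i) (W (r i) * T s)) - S (Function.update W (r i) (W (r i) * T s'))| ≤
              K * |s - s'| ∧
          |S (Function.update W (r i) (T s * W (r i))) - S (Function.update W (r i) (T s' * W (r i)))| ≤
              K * |s - s'|) →
        ∀ β : ℝ, 0 ≤ β → ∀ W : E → SU3,
          Real.exp (-(β * S W)) /
              (∫ W', Real.exp (-(β * S W')) ∂(Measure.pi fun _ : E => haarProbability SU3)) ≤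
            C * (1 + β) ^ p) := by
  intro H
  obtain ⟨C, p, hC, H⟩ := H 1 0
  -- the one-link deviation `s(g) = 1 - ‖g₀₀‖² ∈ [0, 1]`
  let sdev : SU3 → ℝ := fun g => 1 - ‖(g : Matrix (Fin 3) (Fin 3) ℂ) 0 0‖ ^ 2
  have hs_cont : Continuous sdev :=
    continuous_const.sub ((continuous_norm.comp ((continuous_apply_apply 0 0).comp continuous_subtype_val)).pow 2)
  have hs_nn : ∀ g, 0 ≤ sdev g := fun g => by
    have h1 := entry_norm_le_one g 0 0
    have h0 : 0 ≤ ‖(g : Matrix (Fin 3) (Fin 3) ℂ) 0 0‖ := norm_nonneg _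
    show 0 ≤ 1 - ‖(g : Matrix (Fin 3) (Fin 3) ℂ) 0 0‖ ^ 2
    nlinarith
  -- the Haar measure on the single link and the product measure on `Fin 1`
  haveI : (haarProbability SU3).IsOpenPosMeasure := by unfold haarProbability; infer_instance
  haveI hprob : IsProbabilityMeasure (haarProbability SU3) := by infer_instance
  let μ : Measure (Fin 1 → SU3) := Measure.pi fun _ => haarProbability SU3
  haveI : IsProbabilityMeasure μ := by
    show IsProbabilityMeasure (Measure.pi fun _ : Fin 1 => haarProbability SU3); infer_instance
  -- target mass
  set δ : ℝ := 1 / (2 * (C * (1 + 1) ^ p)) with hδ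
  have hC2 : 0 < C * (1 + 1 : ℝ) ^ p := mul_pos hC (Real.rpow_pos_of_pos (by norm_num) _)
  have hδ0 : 0 < δ := by positivity
  -- Step 1: a level `σ > 0` with `Haar{sdev < σ} < δ/2` (continuity from above towards the null set `{sdev = 0}`)
  have hnull : haarProbability SU3 {g : SU3 | sdev g ≤ 0} = 0 := by
    have hsub : {g : SU3 | sdev g ≤ 0} ⊆ {g : SU3 | ‖(g : Matrix (Fin 3) (Fin 3) ℂ) 0 0‖ = 1} := by
      intro g hg
      have h1 := entry_norm_le_one g 0 0
      have h0 : 0 ≤ ‖(g : Matrix (Fin 3) (Fin 3) ℂ) 0 0‖ := norm_nonneg _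
      have hg' : 1 - ‖(g : Matrix (Fin 3) (Fin 3) ℂ) 0 0‖ ^ 2 ≤ 0 := hg
      show ‖(g : Matrix (Fin 3) (Fin 3) ℂ) 0 0‖ = 1
      nlinarith
    exact measure_mono_null hsub haar_norm00_eq_one_null
  have htend : Tendsto (fun k : ℕ => haarProbability SU3 {g : SU3 | sdev g < 1 / ((k : ℝ) + 1)}) atTop
      (nhds (haarProbability SU3 (⋂ k : ℕ, {g : SU3 | sdev g < 1 / ((k : ℝ) + 1)}))) := by
    refine tendsto_measure_iInter_atTop (fun k => ?_) (fun k l hkl => ?_) ⟨0, measure_ne_top _ _⟩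
    · exact (isOpen_lt hs_cont continuous_const).measurableSet.nullMeasurableSet
    · intro g hg
      have hg' : sdev g < 1 / ((l : ℝ) + 1) := hg
      show sdev g < 1 / ((k : ℝ) + 1)
      have : 1 / ((l : ℝ) + 1) ≤ 1 / ((k : ℝ) + 1) :=
        one_div_le_one_div_of_le (by positivity) (by exact_mod_cast Nat.add_le_add_right hkl 1)
      linarith
  have hInter : (⋂ k : ℕ, {g : SU3 | sdev g < 1 / ((k : ℝ) + 1)}) = {g : SU3 | sdev g ≤ 0} := by
    ext g
    simp only [Set.mem_iInter, Set.mem_setOf_eq]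
    constructor
    · intro h
      by_contra hpos
      push Not at hpos
      obtain ⟨k, hk⟩ := exists_nat_one_div_lt hpos
      have := h k
      linarith
    · intro h k
      have : 0 < 1 / ((k : ℝ) + 1) := by positivity
      linarith
  rw [hInter, hnull] at htend
  have hδ2 : (0 : ENNReal) < ENNReal.ofReal (δ / 2) := ENNReal.ofReal_pos.2 (by positivity)
  obtain ⟨k₀, hk₀⟩ := (ENNReal.tendsto_atTop_zero.1 htend) (ENNReal.ofReal (δ / 2)) hδ2
  set σ : ℝ := 1 / ((k₀ : ℝ) + 1) with hσ
  have hσ0 : 0 < σ := by positivity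
  have hsmall : (haarProbability SU3 {g : SU3 | sdev g < σ}).toReal ≤ δ / 2 := by
    have := hk₀ k₀ le_rfl
    rw [← ENNReal.ofReal_toReal (measure_ne_top _ _)] at this
    exact (ENNReal.ofReal_le_ofReal_iff (by positivity)).1 this
  -- Step 2: `λ > 0` with `e^{-λσ} < δ/2` (from `y + 1 ≤ e^y`)
  set lam : ℝ := (2 / δ + 1) / σ with hlam
  have hlam0 : 0 < lam := by positivity
  have hlamσ : lam * σ = 2 / δ + 1 := by rw [hlam]; field_simp
  have hexp : Real.exp (-(lam * σ)) < δ / 2 := by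
    rw [hlamσ, Real.exp_neg]
    have h1 : 2 / δ + 1 + 1 ≤ Real.exp (2 / δ + 1) := Real.add_one_le_exp _
    have h2 : 0 < 2 / δ + 1 + 1 := by positivity
    calc (Real.exp (2 / δ + 1))⁻¹ ≤ (2 / δ + 1 + 1)⁻¹ := inv_anti₀ h2 h1
      _ < (2 / δ)⁻¹ := inv_strictAnti₀ (by positivity) (by linarith)
      _ = δ / 2 := by rw [inv_div]
  -- Step 3: the witness action on one link
  let S : (Fin 1 → SU3) → ℝ := fun W => lam * sdev (W 0)
  have hS_cont : Continuous S := continuous_const.mul (hs_cont.comp (continuous_apply 0))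
  have hS_dep : ∀ W W' : Fin 1 → SU3, (∀ i : Fin 1, W (id i) = W' (id i)) → S W = S W' := by
    intro W W' h
    have : W = W' := funext fun i => h i
    rw [this]
  have hS_lip : ∀ (W : Fin 1 → SU3) (i : Fin 1) (s s' : ℝ),
      |S (Function.update W (id i) (W (id i) * T s)) - S (Function.update W (id i) (W (id i) * T s'))| ≤
          0 * |s - s'| ∧
      |S (Function.update W (id i) (T s * W (id i))) - S (Function.update W (id i) (T s' * W (id i)))| ≤
          0 * |s - s'| := by
    intro W i s s'
    obtain rfl : i = 0 := Subsingleton.elim i 0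
    constructor
    · have h1 : S (Function.update W (id 0) (W (id 0) * T s)) = lam * sdev (W 0) := by
        show lam * sdev (Function.update W 0 (W 0 * T s) 0) = _
        rw [Function.update_self]
        simp only [sdev, norm_mul_diag_00 T hT]
      have h2 : S (Function.update W (id 0) (W (id 0) * T s')) = lam * sdev (W 0) := by
        show lam * sdev (Function.update W 0 (W 0 * T s') 0) = _
        rw [Function.update_self]
        simp only [sdev, norm_mul_diag_00 T hT]
      rw [h1, h2, sub_self, abs_zero, zero_mul]
    · have h1 : S (Function.update W (id 0) (T s * W (id 0))) = lam * sdev (W 0) := by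
        show lam * sdev (Function.update W 0 (T s * W 0) 0) = _
        rw [Function.update_self]
        simp only [sdev, norm_diag_mul_00 T hT]
      have h2 : S (Function.update W (id 0) (T s' * W (id 0))) = lam * sdev (W 0) := by
        show lam * sdev (Function.update W 0 (T s' * W 0) 0) = _
        rw [Function.update_self]
        simp only [sdev, norm_diag_mul_00 T hT]
      rw [h1, h2, sub_self, abs_zero, zero_mul]
  -- the bound at `β = 1`, `W ≡ 1`
  have key := H (Fin 1) (Fin 1) id (by simp) S hS_cont hS_dep hS_lip 1 zero_le_one (fun _ => 1)
  have hS1 : S (fun _ => 1) = 0 := by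
    show lam * (1 - ‖((1 : SU3) : Matrix (Fin 3) (Fin 3) ℂ) 0 0‖ ^ 2) = 0
    simp
  rw [hS1, mul_zero, neg_zero, Real.exp_zero] at key
  -- Step 4: the partition function is `≤ δ`, contradiction with `1/Z ≤ C 2^p = 1/(2δ)`
  set Z : ℝ := ∫ W', Real.exp (-(1 * S W')) ∂μ with hZ
  have hf_cont : Continuous fun W' : Fin 1 → SU3 => Real.exp (-(1 * S W')) :=
    Real.continuous_exp.comp ((continuous_const.mul hS_cont).neg)
  have hS_nn : ∀ W', 0 ≤ S W' := fun W' => mul_nonneg hlam0.le (hs_nn _)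
  have hf_le_one : ∀ W' : Fin 1 → SU3, Real.exp (-(1 * S W')) ≤ 1 := fun W' => by
    rw [Real.exp_le_one_iff]; have := hS_nn W'; linarith
  have hf_int : Integrable (fun W' : Fin 1 → SU3 => Real.exp (-(1 * S W'))) μ := by
    refine Integrable.mono' (integrable_const (1 : ℝ)) hf_cont.aestronglyMeasurable
      (ae_of_all _ fun W' => ?_)
    rw [Real.norm_eq_abs, abs_of_pos (Real.exp_pos _)]
    exact hf_le_one W'
  have hZpos : 0 < Z := integral_exp_pos hf_int
  -- the level set on the product space
  let A : Set (Fin 1 → SU3) := {W' | sdev (W' 0) < σ}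
  have hA_meas : MeasurableSet A :=
    (isOpen_lt (hs_cont.comp (continuous_apply 0)) continuous_const).measurableSet
  have hA_mass : (μ A).toReal ≤ δ / 2 := by
    have hpi : μ A = haarProbability SU3 {g : SU3 | sdev g < σ} := by
      have hAeq : A = Set.pi Set.univ (fun _ : Fin 1 => {g : SU3 | sdev g < σ}) := by
        ext W'
        simp only [A, Set.mem_setOf_eq, Set.mem_univ_pi]
        constructor
        · intro h i; obtain rfl : i = 0 := Subsingleton.elim i 0; exact h
        · intro h; exact h 0
      rw [hAeq]
      show (Measure.pi fun _ : Fin 1 => haarProbability SU3) (Set.pi Set.univ _) = _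
      rw [Measure.pi_pi]
      simp
    rw [hpi]
    exact hsmall
  have hbound : ∀ W' : Fin 1 → SU3,
      Real.exp (-(1 * S W')) ≤ A.indicator (fun _ => (1 : ℝ)) W' + Real.exp (-(lam * σ)) := by
    intro W'
    by_cases hW : W' ∈ A
    · rw [Set.indicator_of_mem hW]
      linarith [hf_le_one W', Real.exp_pos (-(lam * σ))]
    · rw [Set.indicator_of_notMem hW, zero_add]
      apply Real.exp_le_exp.2
      have hσle : σ ≤ sdev (W' 0) := not_lt.1 hW
      have : lam * σ ≤ S W' := by
        show lam * σ ≤ lam * sdev (W' 0)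
        exact mul_le_mul_of_nonneg_left hσle hlam0.le
      linarith
  have hZle : Z ≤ δ := by
    have hint2 : Integrable (fun W' : Fin 1 → SU3 =>
        A.indicator (fun _ => (1 : ℝ)) W' + Real.exp (-(lam * σ))) μ :=
      ((integrable_const (1 : ℝ)).indicator hA_meas).add (integrable_const _)
    calc Z ≤ ∫ W', (A.indicator (fun _ => (1 : ℝ)) W' + Real.exp (-(lam * σ))) ∂μ :=
          integral_mono hf_int hint2 hbound
      _ = (μ A).toReal + Real.exp (-(lam * σ)) := by
          rw [integral_add ((integrable_const (1 : ℝ)).indicator hA_meas) (integrable_const _),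
            integral_indicator_const _ hA_meas, integral_const, smul_eq_mul, smul_eq_mul, mul_one,
            probReal_univ, one_mul, measureReal_def]
      _ ≤ δ / 2 + δ / 2 := add_le_add hA_mass hexp.le
      _ = δ := by ring
  -- `1 / Z ≤ C 2^p = 1/(2δ)` forces `Z ≥ 2δ`
  have hkey : 1 / Z ≤ C * (1 + 1) ^ p := key
  rw [div_le_iff₀ hZpos] at hkey
  have : 1 ≤ C * (1 + 1) ^ p * δ := hkey.trans (mul_le_mul_of_nonneg_left hZle hC2.le)
  rw [hδ] at this
  have h2 : C * (1 + 1) ^ p * (1 / (2 * (C * (1 + 1) ^ p))) = 1 / 2 := by field_simp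
  linarith

end OneSidedUntilt

/-- `‖e^{it} − e^{it'}‖ ≤ |t − t'|`. [folklore] -/
theorem norm_exp_mul_I_sub_le (t t' : ℝ) :
    ‖Complex.exp (t * Complex.I) - Complex.exp (t' * Complex.I)‖ ≤ |t - t'| := by
  have h : Complex.exp (t * Complex.I) - Complex.exp (t' * Complex.I) =
      Complex.exp (t' * Complex.I) * (Complex.exp (Complex.I * ((t - t' : ℝ) : ℂ)) - 1) := by
    rw [mul_sub, mul_one, ← Complex.exp_add]
    congr 1
    push_cast
    ring_nf
  rw [h, norm_mul, Complex.norm_exp_ofReal_mul_I, one_mul]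
  have := Real.norm_exp_I_mul_ofReal_sub_one_le (x := t - t')
  rw [Real.norm_eq_abs] at this
  exact this

/-- **The exponent of `FibreDensity` must depend on the number `n` of listed coordinates.**  With
`Fintype.card ι ≤ n` dropped (constants depending on `K` only) the abstract untilt statement is FALSE:
`S(W) = Σ_{e<N} (1 − Re W(e)₀₀)` is `2`-Lipschitz along every two-sided circle, vanishes at `W ≡ 1`, and
`∫ e^{−S} dHaar^N = z^N` with `z = ∫ e^{−(1 − Re g₀₀)} dHaar(g) < 1`, so the tilted density at `1`, `β = 1`,
is `z^{−N} → ∞`.  (For the crux `n ≤ 16`; this only says `p` must grow with `n`.) [folklore] -/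
theorem not_fibreDensity_uniform_in_n (T : ℝ → SU3)
    (hT : ∀ θ : ℝ, ((T θ : SU3) : Matrix (Fin 3) (Fin 3) ℂ) =
      Matrix.diagonal ![Complex.exp (θ * Complex.I), Complex.exp (-(θ * Complex.I)), 1]) :
    ¬ (∀ K : ℝ, ∃ C p : ℝ, 0 < C ∧
      ∀ (E : Type) [Fintype E] [DecidableEq E] (ι : Type) [Fintype ι] (r : ι → E),
      ∀ S : (E → SU3) → ℝ, Continuous S →
        (∀ W W' : E → SU3, (∀ i, W (r i) = W' (r i)) → S W = S W') →
        (∀ (W : E → SU3) (i : ι) (A B : SU3) (s s' : ℝ),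
          |S (Function.update W (r i) (A * T s * B)) -
              S (Function.update W (r i) (A * T s' * B))| ≤ K * |s - s'|) →
        ∀ β : ℝ, 0 ≤ β → ∀ W : E → SU3,
          Real.exp (-(β * S W)) /
              (∫ W', Real.exp (-(β * S W')) ∂(Measure.pi fun _ : E => haarProbability SU3)) ≤
            C * (1 + β) ^ p) := by
  intro H
  obtain ⟨C, p, hC, H⟩ := H 2
  -- one-link deviation `s(g) = 1 - Re g₀₀ ∈ [0, 2]`
  let sdev : SU3 → ℝ := fun g => 1 - ((g : Matrix (Fin 3) (Fin 3) ℂ) 0 0).re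
  have hs_cont : Continuous sdev :=
    continuous_const.sub (Complex.continuous_re.comp ((continuous_apply_apply 0 0).comp continuous_subtype_val))
  have hs_nn : ∀ g, 0 ≤ sdev g := fun g => by have := (re00_bounds g).2; show 0 ≤ 1 - _; linarith
  haveI : (haarProbability SU3).IsOpenPosMeasure := by unfold haarProbability; infer_instance
  haveI hprob : IsProbabilityMeasure (haarProbability SU3) := by infer_instance
  -- the one-link partition function `z < 1`
  set z : ℝ := ∫ g, Real.exp (-sdev g) ∂(haarProbability SU3) with hz
  have hf_cont : Continuous fun g : SU3 => Real.exp (-sdev g) := Real.continuous_exp.comp hs_cont.neg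
  have hf_le : ∀ g : SU3, Real.exp (-sdev g) ≤ 1 := fun g => by
    rw [Real.exp_le_one_iff]; have := hs_nn g; linarith
  have hf_int : Integrable (fun g : SU3 => Real.exp (-sdev g)) (haarProbability SU3) := by
    refine Integrable.mono' (integrable_const (1 : ℝ)) hf_cont.aestronglyMeasurable (ae_of_all _ fun g => ?_)
    rw [Real.norm_eq_abs, abs_of_pos (Real.exp_pos _)]; exact hf_le g
  have hz0 : 0 < z := integral_exp_pos hf_int
  have hz1 : z < 1 := by
    -- `1 - z = ∫ (1 - e^{-s}) > 0`
    have hg_int : Integrable (fun g : SU3 => 1 - Real.exp (-sdev g)) (haarProbability SU3) :=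
      (integrable_const _).sub hf_int
    have hpos : 0 < ∫ g, (1 - Real.exp (-sdev g)) ∂(haarProbability SU3) := by
      rw [integral_pos_iff_support_of_nonneg (fun g => by have := hf_le g; simp only [Pi.zero_apply]; linarith) hg_int]
      let g₀ : SU3 := ⟨Matrix.diagonal ![(-1 : ℂ), -1, 1], negneg_mem_specialUnitaryGroup⟩
      have hopen : IsOpen {g : SU3 | 0 < sdev g} := isOpen_lt continuous_const hs_cont
      have hg₀ : g₀ ∈ {g : SU3 | 0 < sdev g} := by
        show 0 < 1 - ((Matrix.diagonal ![(-1 : ℂ), -1, 1] : Matrix (Fin 3) (Fin 3) ℂ) 0 0).re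
        simp only [Matrix.diagonal_apply_eq, Matrix.cons_val_zero]
        norm_num
      have hsub : {g : SU3 | 0 < sdev g} ⊆ Function.support fun g : SU3 => 1 - Real.exp (-sdev g) := by
        intro g hg
        rw [Function.mem_support]
        have : Real.exp (-sdev g) < 1 := by rw [Real.exp_lt_one_iff]; have h' : 0 < sdev g := hg; linarith
        linarith
      exact (hopen.measure_pos _ ⟨g₀, hg₀⟩).trans_le (measure_mono hsub)
    rw [integral_sub (integrable_const _) hf_int, integral_const, smul_eq_mul, mul_one, probReal_univ] at hpos
    linarith
  -- choose `N` with `C 2^p z^N < 1`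
  have hC2 : 0 < C * (1 + 1 : ℝ) ^ p := mul_pos hC (Real.rpow_pos_of_pos (by norm_num) _)
  obtain ⟨N, hN⟩ : ∃ N : ℕ, z ^ N < 1 / (C * (1 + 1) ^ p) :=
    exists_pow_lt_of_lt_one (by positivity) hz1
  -- the witness action on `N` links
  let S : (Fin N → SU3) → ℝ := fun W => ∑ e, sdev (W e)
  have hS_cont : Continuous S := continuous_finsetSum _ fun e _ => hs_cont.comp (continuous_apply e)
  have hS_dep : ∀ W W' : Fin N → SU3, (∀ i : Fin N, W (id i) = W' (id i)) → S W = S W' := by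
    intro W W' h; have : W = W' := funext fun i => h i; rw [this]
  have hS_lip : ∀ (W : Fin N → SU3) (i : Fin N) (A B : SU3) (s s' : ℝ),
      |S (Function.update W (id i) (A * T s * B)) - S (Function.update W (id i) (A * T s' * B))| ≤
        2 * |s - s'| := by
    intro W i A B s s'
    -- only the `i`-th summand moves
    have hsplit : ∀ g : SU3, S (Function.update W i g) = sdev g + ∑ e ∈ ({i}ᶜ : Finset (Fin N)), sdev (W e) := by
      intro g
      show ∑ e, sdev (Function.update W i g e) = _
      rw [Fintype.sum_eq_add_sum_compl i, Function.update_self]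
      congr 1
      refine Finset.sum_congr rfl fun e he => ?_
      rw [Finset.mem_compl, Finset.mem_singleton] at he
      rw [Function.update_of_ne he]
    have h1 : S (Function.update W (id i) (A * T s * B)) - S (Function.update W (id i) (A * T s' * B)) =
        sdev (A * T s * B) - sdev (A * T s' * B) := by
      show S (Function.update W i (A * T s * B)) - S (Function.update W i (A * T s' * B)) = _
      rw [hsplit, hsplit]; ring
    rw [h1]
    show |(1 - (((A * T s * B : SU3) : Matrix (Fin 3) (Fin 3) ℂ) 0 0).re) -
        (1 - (((A * T s' * B : SU3) : Matrix (Fin 3) (Fin 3) ℂ) 0 0).re)| ≤ 2 * |s - s'|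
    rw [entry00_twoSided T hT A B s, entry00_twoSided T hT A B s']
    set c₁ : ℂ := (A : Matrix (Fin 3) (Fin 3) ℂ) 0 0 * (B : Matrix (Fin 3) (Fin 3) ℂ) 0 0 with hc₁
    set cm : ℂ := (A : Matrix (Fin 3) (Fin 3) ℂ) 0 1 * (B : Matrix (Fin 3) (Fin 3) ℂ) 1 0 with hcm
    set c₀ : ℂ := (A : Matrix (Fin 3) (Fin 3) ℂ) 0 2 * (B : Matrix (Fin 3) (Fin 3) ℂ) 2 0 with hc₀
    have hc₁n : ‖c₁‖ ≤ 1 := by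
      rw [hc₁, norm_mul]
      exact mul_le_one₀ (entry_norm_le_one A 0 0) (norm_nonneg _) (entry_norm_le_one B 0 0)
    have hcmn : ‖cm‖ ≤ 1 := by
      rw [hcm, norm_mul]
      exact mul_le_one₀ (entry_norm_le_one A 0 1) (norm_nonneg _) (entry_norm_le_one B 1 0)
    have hdiff : (1 - (c₁ * Complex.exp (s * Complex.I) + cm * Complex.exp (-(s * Complex.I)) + c₀).re) -
        (1 - (c₁ * Complex.exp (s' * Complex.I) + cm * Complex.exp (-(s' * Complex.I)) + c₀).re) =
        -((c₁ * (Complex.exp (s * Complex.I) - Complex.exp (s' * Complex.I)) +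
            cm * (Complex.exp (-(s * Complex.I)) - Complex.exp (-(s' * Complex.I)))).re) := by
      simp only [Complex.add_re, Complex.sub_re, mul_sub, Complex.mul_re]
      ring
    rw [hdiff, abs_neg]
    have hA : ‖c₁ * (Complex.exp (s * Complex.I) - Complex.exp (s' * Complex.I))‖ ≤ |s - s'| := by
      rw [norm_mul]
      calc ‖c₁‖ * ‖Complex.exp (s * Complex.I) - Complex.exp (s' * Complex.I)‖ ≤ 1 * |s - s'| :=
            mul_le_mul hc₁n (norm_exp_mul_I_sub_le s s') (norm_nonneg _) zero_le_one
        _ = |s - s'| := one_mul _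
    have hB : ‖cm * (Complex.exp (-(s * Complex.I)) - Complex.exp (-(s' * Complex.I)))‖ ≤ |s - s'| := by
      rw [norm_mul]
      have hneg : ‖Complex.exp (-(s * Complex.I)) - Complex.exp (-(s' * Complex.I))‖ ≤ |s - s'| := by
        have := norm_exp_mul_I_sub_le (-s) (-s')
        push_cast at this
        rw [neg_mul, neg_mul] at this
        calc _ ≤ |(-s) - (-s')| := this
          _ = |s - s'| := by rw [neg_sub_neg, abs_sub_comm]
      calc ‖cm‖ * ‖Complex.exp (-(s * Complex.I)) - Complex.exp (-(s' * Complex.I))‖ ≤ 1 * |s - s'| :=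
            mul_le_mul hcmn hneg (norm_nonneg _) zero_le_one
        _ = |s - s'| := one_mul _
    calc |(c₁ * (Complex.exp (s * Complex.I) - Complex.exp (s' * Complex.I)) +
            cm * (Complex.exp (-(s * Complex.I)) - Complex.exp (-(s' * Complex.I)))).re|
        ≤ ‖c₁ * (Complex.exp (s * Complex.I) - Complex.exp (s' * Complex.I)) +
            cm * (Complex.exp (-(s * Complex.I)) - Complex.exp (-(s' * Complex.I)))‖ :=
          Complex.abs_re_le_norm _
      _ ≤ ‖c₁ * (Complex.exp (s * Complex.I) - Complex.exp (s' * Complex.I))‖ +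
            ‖cm * (Complex.exp (-(s * Complex.I)) - Complex.exp (-(s' * Complex.I)))‖ := norm_add_le _ _
      _ ≤ |s - s'| + |s - s'| := add_le_add hA hB
      _ = 2 * |s - s'| := by ring
  -- the bound at `β = 1`, `W ≡ 1`
  let μ : Measure (Fin N → SU3) := Measure.pi fun _ => haarProbability SU3
  have key := H (Fin N) (Fin N) id S hS_cont hS_dep hS_lip 1 zero_le_one (fun _ => 1)
  have hS1 : S (fun _ => 1) = 0 := by
    show ∑ e : Fin N, (1 - (((1 : SU3) : Matrix (Fin 3) (Fin 3) ℂ) 0 0).re) = 0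
    simp
  rw [hS1, mul_zero, neg_zero, Real.exp_zero] at key
  -- the partition function factorises: `Z = z^N`
  have hZ : (∫ W', Real.exp (-(1 * S W')) ∂μ) = z ^ N := by
    have h1 : (fun W' : Fin N → SU3 => Real.exp (-(1 * S W'))) =
        fun W' => ∏ e, Real.exp (-sdev (W' e)) := by
      funext W'
      rw [one_mul]
      show Real.exp (-(∑ e, sdev (W' e))) = _
      rw [← Finset.sum_neg_distrib, Real.exp_sum]
    have hprod := integral_fintype_prod_eq_prod (ι := Fin N) (μ := fun _ : Fin N => haarProbability SU3)
      (fun (_ : Fin N) (g : SU3) => Real.exp (-sdev g))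
    rw [h1]
    show (∫ W', ∏ e, Real.exp (-sdev (W' e)) ∂(Measure.pi fun _ : Fin N => haarProbability SU3)) = z ^ N
    rw [hprod, Finset.prod_const, Finset.card_univ, Fintype.card_fin]
  have hkey : 1 / z ^ N ≤ C * (1 + 1) ^ p := by rw [← hZ]; exact key
  have hzN : 0 < z ^ N := pow_pos hz0 N
  rw [div_le_iff₀ hzN] at hkey
  rw [lt_div_iff₀ hC2] at hN
  linarith

end Gen2Targets

/-! ### §10.3  Further natural strengthenings of the r2b stubs — believed FALSE, not certified (for the record)

* (`FibreSmallBalls` with constants uniform in `n`: FALSE — now CERTIFIED, `not_fibreSmallBalls_uniform_in_n`, §10.2.)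
* (`FibreDensity` with `p` uniform in `n`: FALSE — now CERTIFIED, `not_fibreDensity_uniform_in_n`, §10.2.)
* (`FibreDensity` with ONE-SIDED Lipschitz circles only: FALSE — now CERTIFIED, `not_fibreDensity_oneSided`, §10.2,
  via the Haar-nullity lemma `haar_norm00_eq_one_null`.)
* `TorusSmallBalls` with `c = 1/(2D)` for all `m`: FALSE for `m ≥ 2` (`q = Π_j (1 − cos θ_j)^D`: sublevel volume
  `≍ η^{1/(2D)} log^{m−1}(1/η)`; drefute toy confirms the log); harmless (`c` existential).
* `Nikolskii` with constant `< D + 1`: FALSE (Fejér kernel attains `sup/⨍ = D+1`); the stub's `2D+1` has slack.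

### Next attacks (if re-armed on stuck stubs): the lead's HANDOFF `STUCK` signatures first; then the
`TorusSmallBalls` log-factor at `m = 2` and the sharp Nikolskii constant `D + 1` (both harmless to the line). -/

end Summit.QuantumFields.QCD.Cruxes.TiltedFlatness.Disproof
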